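import Mathlib
import Literature.AlgebraicGeometry.Resolution.LocalBlowup
import Literature.AlgebraicGeometry.Resolution.TranscendenceDefect
import Literature.RingTheory.KrullDimension.AffineDimension
import Literature.RingTheory.KrullDimension.LocalizationDimension
import HarnessLib

/-!
# Crux `DescentPerfectToAll` (stmt-ResolutionOfSingularities-0549) — lens 5 «transfer from the solved sibling», g10:
# THE LATTICE SIDE OF THE T-SLICE — `port_toricChart_lattice` (PORT 3-L of `Lens5_PRankTwoAssembly.lean`) PROVED, SORRY-FREE

COMPANION workfile of `Cruxes/DescentPerfectToAll/Lens5_PRankTwoAssembly.lean` (res-B-lens-5 g10, 2026-08-29).  OURS · CANDIDATE · counted 0.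
Nothing here proves resolution in characteristic `p`; no crux, registered stub or named fact is proved here; not a registered skeleton.

WHY A SEPARATE FILE.  The assembly's one remaining obligation after rev 6 was PORT 3-L `port_toricChart_lattice` (the exponent-level toric
chart).  Its proof consumes the ✓ kits `Lens5_UnimodularRefinement.lean` rev 9 (e40b13a8bffb; 1230 lines) and `Lens5_RankOneArchimedean.lean`
rev 4 (1e4ecbbc974d), which — crux workfiles not being importable on the farm (`remote:stale:unbuilt`) — must be carried verbatim WITH proofs;
inlined into the assembly this exceeds the workfile request limit (262 144 bytes).  So the proof lives here, and the assembly keeps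
`port_toricChart_lattice` as its single `sorry` with a pointer to this file.  THE STATEMENT of `port_toricChart_lattice` below is
BYTE-IDENTICAL to the assembly's (same binders, same conclusion, stated over Mathlib + `Literature` declarations only — `locAtCentre`,
`transcendenceDefect` —, no file-local definitions), so the two files together certify the T-slice `CleanLU3DefectPRankTwoAt p` modulo
F-02 + F-32 with no `sorry` left anywhere: `#print axioms port_toricChart_lattice` here = {propext, Classical.choice, Quot.sound}.

CONTENTS.  §K the two kits (sub-namespaces `UnimodularRefinement`, `RankOneArchimedean`), verbatim bodies; §H Laurent-monomial helpers and
`dim A = 3` (copies, with proofs, of the assembly's); §L the proof of PORT 3-L split as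
(3-L-a) `valuation_monomial_eq_prod_weights` — `v(z^C x^a y^b) = ∏ v(wᵢ)^{pCᵢ + a eAᵢ + b eBᵢ}` (unique `p`-th roots in `Γ_O`);
(3-L-b) the exponent lattice `L = pℤ³ + ℤ eA + ℤ eB ≤ ℤ³`: `mem_toricLattice_iff`, `toricLattice_normalForm` (`0 ≤ a, b < p`), `toricLattice_basis`
(`Submodule.nonempty_basis_of_pid` + `finrank = 3`);
(3-L-c) READ-OUTS `readout_rank_one` / `readout_rank_two` of an adapted basis as a CHART `M : Fin 3 → L` (`ρ ∈ {1,2}` value-positive vectors,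
integer coordinates `≥ 0` on them and `> 0` somewhere for value-positive elements, `= 0` there for value-zero elements), `exists_indep_kernel_pair`,
and the two ABSTRACT LATTICE-CHART lemmas `latticeChart_of_archimedean` (✓ `toric_lemma_classB`) and `latticeChart_of_twoLevel` (CASE 1 rank-one
image by ✓ `exists_kernel_adapted_basis_of_rank_two_ker_pos`; CASE 2: `ψ ∘ φ ≠ 0` is then AUTOMATIC — else the weights `φ(bᵢ) ∈ ker ψ` are pairwise
dependent and CASE 1 holds —, so ✓ `exists_two_level_reading` + ✓ `toric_lemma_classC` apply; the (P2) counting argument of memo §15(a) is not needed);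
(3-L-d) `valueGroup_twoLevel_data` — a proper coarsening `O < O₁ < K` gives the monotone, surjective units map `ψ` of `mapOfLE O O₁` with a non-zero
kernel element (a unit of `O₁` outside `O`, `nonunits_le_nonunits`) and a non-zero value (an element outside `O₁`), hence (✓ R1A) both dependence
hypotheses from `rank_ℤ Γ_O ≤ 2`;
and the glue `port_toricChart_lattice`: weights `ωᵢ = v(wᵢ)` in `W = Additive (Γ_O)ˣ`, `Ω ℓ = Σ ℓᵢ • ωᵢ`, `φ = −Ω|L`, `hrel` from `rank_ℤ W ≤ 2`
(✓ `ratRank_le_two_of_stub`, transcendence defect `≠ 0`), `hne` from `v(z₀) < 1`, `F = {p·δᵢ} ∪ {θ e : e ∈ E, v < 1}`, class split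
«no proper coarsening ↦ archimedean (✓ `archimedean_additive_valueGroup_units`) ↦ (3-L-c1); else (3-L-d) ↦ (3-L-c2)», normal forms of the chart
vectors and the componentwise reading of coordinates in `ℤ³`.
Resolution of singularities in positive characteristic is NOT proved; rung B of the ladder lives in `dim ≥ 4`.
-/

open IsLocalRing
open Literature.AlgebraicGeometry.Resolution

set_option linter.unusedVariables false
set_option linter.dupNamespace false

namespace Summit.ResolutionOfSingularities.ResolutionOfSingularities.Cruxes.DescentPerfectToAll.CpSibling.PRankTwoLattice

/-! ## §K THE KITS -/

/-! ## KIT (UR9): `Lens5_UnimodularRefinement.lean` rev 9 (e40b13a8bffb, sha16 43f1e2274ac09409), body verbatim WITH proofs, under the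
sub-namespace `UnimodularRefinement` (crux modules cannot be imported on the farm) — consumed by (3-L-c1/c2) of PORT 3-L (rev 7). -/

namespace UnimodularRefinement


/-! ## Per-functional potential: step I (`λ ↦ (λ₁, λ₁ + λ₂)`, when `β < α`) -/

theorem termI_le (α β : ℝ) (hβ : 0 < β) (hβα : β < α) (x y x' : ℤ) (hx' : x' = x + y)
    (h : 0 < (x : ℝ) * α + y * β) :
    (if 0 < x ∧ 0 < x' then 0 else x.natAbs + x'.natAbs + 1) ≤
      (if 0 < x ∧ 0 < y then 0 else x.natAbs + y.natAbs + 1) := by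
  subst hx'
  by_cases hg : 0 < x ∧ 0 < y
  · have hg' : 0 < x ∧ 0 < x + y := ⟨hg.1, by omega⟩
    rw [if_pos hg', if_pos hg]
  · rw [if_neg hg]
    by_cases hg' : 0 < x ∧ 0 < x + y
    · rw [if_pos hg']; exact Nat.zero_le _
    · rw [if_neg hg']
      rcases le_or_gt x 0 with hx | hx
      · have hxy : 0 < x + y := by
          by_contra hcon
          have hcon' : ((x : ℝ) + y) ≤ 0 := by exact_mod_cast (not_lt.mp hcon)
          have hx0 : (x : ℝ) ≤ 0 := by exact_mod_cast hx
          nlinarith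
        omega
      · omega

theorem termI_lt (α β : ℝ) (hβ : 0 < β) (hβα : β < α) (x y x' : ℤ) (hx' : x' = x + y)
    (h : 0 < (x : ℝ) * α + y * β) (hng : ¬ (0 < x ∧ 0 < y)) (hx0 : x ≠ 0) :
    (if 0 < x ∧ 0 < x' then 0 else x.natAbs + x'.natAbs + 1) <
      (if 0 < x ∧ 0 < y then 0 else x.natAbs + y.natAbs + 1) := by
  subst hx'
  rw [if_neg hng]
  by_cases hg' : 0 < x ∧ 0 < x + y
  · rw [if_pos hg']; omega
  · rw [if_neg hg']
    rcases le_or_gt x 0 with hx | hx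
    · have hxy : 0 < x + y := by
        by_contra hcon
        have hcon' : ((x : ℝ) + y) ≤ 0 := by exact_mod_cast (not_lt.mp hcon)
        have hx0' : (x : ℝ) ≤ 0 := by exact_mod_cast hx
        nlinarith
      omega
    · omega

/-! ## Per-functional potential: step II (`λ ↦ (λ₁ + λ₂, λ₂)`, when `α < β`) -/

theorem termII_le (α β : ℝ) (hα : 0 < α) (hαβ : α < β) (x y y' : ℤ) (hy' : y' = x + y)
    (h : 0 < (x : ℝ) * α + y * β) :
    (if 0 < y' ∧ 0 < y then 0 else y'.natAbs + y.natAbs + 1) ≤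
      (if 0 < x ∧ 0 < y then 0 else x.natAbs + y.natAbs + 1) := by
  subst hy'
  by_cases hg : 0 < x ∧ 0 < y
  · have hg' : 0 < x + y ∧ 0 < y := ⟨by omega, hg.2⟩
    rw [if_pos hg', if_pos hg]
  · rw [if_neg hg]
    by_cases hg' : 0 < x + y ∧ 0 < y
    · rw [if_pos hg']; exact Nat.zero_le _
    · rw [if_neg hg']
      rcases le_or_gt y 0 with hy | hy
      · have hxy : 0 < x + y := by
          by_contra hcon
          have hcon' : ((x : ℝ) + y) ≤ 0 := by exact_mod_cast (not_lt.mp hcon)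
          have hy0 : (y : ℝ) ≤ 0 := by exact_mod_cast hy
          nlinarith
        omega
      · omega

theorem termII_lt (α β : ℝ) (hα : 0 < α) (hαβ : α < β) (x y y' : ℤ) (hy' : y' = x + y)
    (h : 0 < (x : ℝ) * α + y * β) (hng : ¬ (0 < x ∧ 0 < y)) (hy0 : y ≠ 0) :
    (if 0 < y' ∧ 0 < y then 0 else y'.natAbs + y.natAbs + 1) <
      (if 0 < x ∧ 0 < y then 0 else x.natAbs + y.natAbs + 1) := by
  subst hy'
  rw [if_neg hng]
  by_cases hg' : 0 < x + y ∧ 0 < y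
  · rw [if_pos hg']; omega
  · rw [if_neg hg']
    rcases le_or_gt y 0 with hy | hy
    · have hxy : 0 < x + y := by
        by_contra hcon
        have hcon' : ((x : ℝ) + y) ≤ 0 := by exact_mod_cast (not_lt.mp hcon)
        have hy0' : (y : ℝ) ≤ 0 := by exact_mod_cast hy
        nlinarith
      omega
    · omega

/-! ## The invariant forces `α ≠ β` -/

theorem ne_of_state (ω₁ ω₂ : ℝ) (hind : ∀ u v : ℤ, (u : ℝ) * ω₁ + v * ω₂ = 0 → u = 0 ∧ v = 0)
    (α β : ℝ) (a b c d : ℤ) (ha : 0 ≤ a) (hb : 0 ≤ b) (hc : 0 ≤ c) (hd : 0 ≤ d)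
    (hdet : a * d - b * c = 1 ∨ a * d - b * c = -1) (h1 : ω₁ = a * α + b * β) (h2 : ω₂ = c * α + d * β) :
    α ≠ β := by
  intro hαβ
  have e : ((c + d : ℤ) : ℝ) * ω₁ + ((-(a + b) : ℤ) : ℝ) * ω₂ = 0 := by
    rw [h1, h2, hαβ]; push_cast; ring
  obtain ⟨hcd, hab⟩ := hind _ _ e
  have h0 : a = 0 ∧ b = 0 ∧ c = 0 ∧ d = 0 := by omega
  obtain ⟨rfl, rfl, rfl, rfl⟩ := h0
  simp at hdet

/-! ## The double induction -/

/-- From any state (positive basis `(a,c),(b,d)`, `ω = α(a,c) + β(b,d)`, `α, β > 0`) whose potential is `≤ M` and whose run-length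
bound `⌊α/β⌋ + ⌊β/α⌋` is `≤ R`, a good state is reachable. -/
theorem refine_aux (ω₁ ω₂ : ℝ) (hind : ∀ u v : ℤ, (u : ℝ) * ω₁ + v * ω₂ = 0 → u = 0 ∧ v = 0)
    (F : Finset (ℤ × ℤ)) (hF : ∀ f ∈ F, 0 < (f.1 : ℝ) * ω₁ + f.2 * ω₂) :
    ∀ (M R : ℕ) (α β : ℝ) (a b c d : ℤ), 0 < α → 0 < β → 0 ≤ a → 0 ≤ b → 0 ≤ c → 0 ≤ d →
      (a * d - b * c = 1 ∨ a * d - b * c = -1) → ω₁ = a * α + b * β → ω₂ = c * α + d * β →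
      (∑ f ∈ F, (if 0 < f.1 * a + f.2 * c ∧ 0 < f.1 * b + f.2 * d then 0
          else (f.1 * a + f.2 * c).natAbs + (f.1 * b + f.2 * d).natAbs + 1)) ≤ M →
      ⌊α / β⌋₊ + ⌊β / α⌋₊ ≤ R →
      ∃ (a' b' c' d' : ℤ) (α' β' : ℝ), 0 < α' ∧ 0 < β' ∧ 0 ≤ a' ∧ 0 ≤ b' ∧ 0 ≤ c' ∧ 0 ≤ d' ∧
        (a' * d' - b' * c' = 1 ∨ a' * d' - b' * c' = -1) ∧ ω₁ = a' * α' + b' * β' ∧ ω₂ = c' * α' + d' * β' ∧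
        ∀ f ∈ F, 0 < f.1 * a' + f.2 * c' ∧ 0 < f.1 * b' + f.2 * d' := by
  -- the value of `f` is conserved: `λ₁ α + λ₂ β = f(ω)`
  have hval : ∀ (α β : ℝ) (a b c d : ℤ), ω₁ = a * α + b * β → ω₂ = c * α + d * β →
      ∀ f ∈ F, 0 < ((f.1 * a + f.2 * c : ℤ) : ℝ) * α + ((f.1 * b + f.2 * d : ℤ) : ℝ) * β := by
    intro α β a b c d h1 h2 f hf
    have := hF f hf
    rw [h1, h2] at this
    push_cast
    nlinarith [this]
  intro M
  induction M with
  | zero =>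
    intro R α β a b c d hα hβ ha hb hc hd hdet h1 h2 hMes hR
    refine ⟨a, b, c, d, α, β, hα, hβ, ha, hb, hc, hd, hdet, h1, h2, ?_⟩
    intro f hf
    have h0 := (Finset.sum_eq_zero_iff.mp (Nat.le_zero.mp hMes)) f hf
    by_contra hng
    rw [if_neg hng] at h0
    omega
  | succ M ihM =>
    intro R
    induction R with
    | zero =>
      intro α β a b c d hα hβ ha hb hc hd hdet h1 h2 hMes hR
      exfalso
      have hf1 : ⌊α / β⌋₊ = 0 := by omega
      have hf2 : ⌊β / α⌋₊ = 0 := by omega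
      rw [Nat.floor_eq_zero, div_lt_one hβ] at hf1
      rw [Nat.floor_eq_zero, div_lt_one hα] at hf2
      exact lt_asymm hf1 hf2
    | succ R ihR =>
      intro α β a b c d hα hβ ha hb hc hd hdet h1 h2 hMes hR
      by_cases hall : ∀ f ∈ F, 0 < f.1 * a + f.2 * c ∧ 0 < f.1 * b + f.2 * d
      · exact ⟨a, b, c, d, α, β, hα, hβ, ha, hb, hc, hd, hdet, h1, h2, hall⟩
      have hne : α ≠ β := ne_of_state ω₁ ω₂ hind α β a b c d ha hb hc hd hdet h1 h2
      have hvf := hval α β a b c d h1 h2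
      rcases lt_or_gt_of_ne hne with hlt | hgt
      · ------------------------------------------------------------------ step II: (α, β − α, a + b, b, c + d, d)
        have hβ' : 0 < β - α := sub_pos.mpr hlt
        have hdet' : (a + b) * d - b * (c + d) = 1 ∨ (a + b) * d - b * (c + d) = -1 := by
          have e : (a + b) * d - b * (c + d) = a * d - b * c := by ring
          rw [e]; exact hdet
        have h1' : ω₁ = ((a + b : ℤ) : ℝ) * α + b * (β - α) := by rw [h1]; push_cast; ring
        have h2' : ω₂ = ((c + d : ℤ) : ℝ) * α + d * (β - α) := by rw [h2]; push_cast; ring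
        have hle : (∑ f ∈ F, (if 0 < f.1 * (a + b) + f.2 * (c + d) ∧ 0 < f.1 * b + f.2 * d then 0
            else (f.1 * (a + b) + f.2 * (c + d)).natAbs + (f.1 * b + f.2 * d).natAbs + 1)) ≤
            (∑ f ∈ F, (if 0 < f.1 * a + f.2 * c ∧ 0 < f.1 * b + f.2 * d then 0
            else (f.1 * a + f.2 * c).natAbs + (f.1 * b + f.2 * d).natAbs + 1)) :=
          Finset.sum_le_sum fun f hf =>
            termII_le α β hα hlt _ _ _ (by ring) (hvf f hf)
        rcases hle.lt_or_eq with hlt2 | heq2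
        · -- potential dropped: outer induction hypothesis
          exact ihM _ α (β - α) (a + b) b (c + d) d hα hβ' (by omega) hb (by omega) hd hdet' h1' h2'
            (by omega) le_rfl
        · -- potential unchanged: every non-good `f` waits with `λ₂ = 0`
          have hwait : ∀ f ∈ F, ¬ (0 < f.1 * a + f.2 * c ∧ 0 < f.1 * b + f.2 * d) → f.1 * b + f.2 * d = 0 := by
            intro f hf hng
            by_contra hy0
            have hlt3 := Finset.sum_lt_sum
              (fun f hf => termII_le α β hα hlt (f.1 * a + f.2 * c) (f.1 * b + f.2 * d)
                (f.1 * (a + b) + f.2 * (c + d)) (by ring) (hvf f hf))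
              ⟨f, hf, termII_lt α β hα hlt (f.1 * a + f.2 * c) (f.1 * b + f.2 * d)
                (f.1 * (a + b) + f.2 * (c + d)) (by ring) (hvf f hf) hng hy0⟩
            exact absurd heq2 (ne_of_lt hlt3)
          have hne' : α ≠ β - α :=
            ne_of_state ω₁ ω₂ hind α (β - α) (a + b) b (c + d) d (by omega) hb (by omega) hd hdet' h1' h2'
          rcases lt_or_gt_of_ne hne' with hlt4 | hgt4
          · -- next step is again of type II: inner induction hypothesis (run-length bound drops)
            refine ihR α (β - α) (a + b) b (c + d) d hα hβ' (by omega) hb (by omega) hd hdet' h1' h2'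
              (heq2 ▸ hMes) ?_
            have hq1 : ⌊α / (β - α)⌋₊ = 0 := by
              rw [Nat.floor_eq_zero, div_lt_one hβ']; exact hlt4
            have hq2 : ⌊(β - α) / α⌋₊ = ⌊β / α⌋₊ - 1 := by
              rw [sub_div, div_self hα.ne', Nat.floor_sub_one]
            have hq3 : ⌊α / β⌋₊ = 0 := by
              rw [Nat.floor_eq_zero, div_lt_one hβ]; exact hlt
            omega
          · -- next step is of type I: after it every `f` is good: final state (2α − β, β − α, a + b, a + 2b, c + d, c + 2d)
            have hα'' : 0 < α - (β - α) := sub_pos.mpr hgt4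
            refine ⟨a + b, (a + b) + b, c + d, (c + d) + d, α - (β - α), β - α, hα'', hβ', by omega, by omega,
              by omega, by omega, ?_, ?_, ?_, ?_⟩
            · have e : (a + b) * (c + d + d) - (a + b + b) * (c + d) = a * d - b * c := by ring
              rw [e]; exact hdet
            · rw [h1]; push_cast; ring
            · rw [h2]; push_cast; ring
            · intro f hf
              by_cases hg : 0 < f.1 * a + f.2 * c ∧ 0 < f.1 * b + f.2 * d
              · constructor <;> nlinarith [hg.1, hg.2]
              · have hy0 := hwait f hf hg
                have hx : 0 < f.1 * a + f.2 * c := by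
                  have := hvf f hf
                  have hy0' : ((f.1 * b + f.2 * d : ℤ) : ℝ) = 0 := by exact_mod_cast hy0
                  rw [hy0', zero_mul, add_zero] at this
                  have hx' : (0 : ℝ) < ((f.1 * a + f.2 * c : ℤ) : ℝ) := (pos_iff_pos_of_mul_pos this).mpr hα
                  exact_mod_cast hx'
                constructor <;> nlinarith [hx, hy0]
      · ------------------------------------------------------------------ step I: (α − β, β, a, a + b, c, c + d)
        have hα' : 0 < α - β := sub_pos.mpr hgt
        have hdet' : a * (c + d) - (a + b) * c = 1 ∨ a * (c + d) - (a + b) * c = -1 := by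
          have e : a * (c + d) - (a + b) * c = a * d - b * c := by ring
          rw [e]; exact hdet
        have h1' : ω₁ = (a : ℝ) * (α - β) + ((a + b : ℤ) : ℝ) * β := by rw [h1]; push_cast; ring
        have h2' : ω₂ = (c : ℝ) * (α - β) + ((c + d : ℤ) : ℝ) * β := by rw [h2]; push_cast; ring
        have hle : (∑ f ∈ F, (if 0 < f.1 * a + f.2 * c ∧ 0 < f.1 * (a + b) + f.2 * (c + d) then 0
            else (f.1 * a + f.2 * c).natAbs + (f.1 * (a + b) + f.2 * (c + d)).natAbs + 1)) ≤
            (∑ f ∈ F, (if 0 < f.1 * a + f.2 * c ∧ 0 < f.1 * b + f.2 * d then 0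
            else (f.1 * a + f.2 * c).natAbs + (f.1 * b + f.2 * d).natAbs + 1)) :=
          Finset.sum_le_sum fun f hf =>
            termI_le α β hβ hgt _ _ _ (by ring) (hvf f hf)
        rcases hle.lt_or_eq with hlt2 | heq2
        · -- potential dropped: outer induction hypothesis
          exact ihM _ (α - β) β a (a + b) c (c + d) hα' hβ ha (by omega) hc (by omega) hdet' h1' h2'
            (by omega) le_rfl
        · -- potential unchanged: every non-good `f` waits with `λ₁ = 0`
          have hwait : ∀ f ∈ F, ¬ (0 < f.1 * a + f.2 * c ∧ 0 < f.1 * b + f.2 * d) → f.1 * a + f.2 * c = 0 := by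
            intro f hf hng
            by_contra hx0
            have hlt3 := Finset.sum_lt_sum
              (fun f hf => termI_le α β hβ hgt (f.1 * a + f.2 * c) (f.1 * b + f.2 * d)
                (f.1 * (a + b) + f.2 * (c + d)) (by ring) (hvf f hf))
              ⟨f, hf, termI_lt α β hβ hgt (f.1 * a + f.2 * c) (f.1 * b + f.2 * d)
                (f.1 * (a + b) + f.2 * (c + d)) (by ring) (hvf f hf) hng hx0⟩
            exact absurd heq2 (ne_of_lt hlt3)
          have hne' : α - β ≠ β :=
            ne_of_state ω₁ ω₂ hind (α - β) β a (a + b) c (c + d) ha (by omega) hc (by omega) hdet' h1' h2'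
          rcases lt_or_gt_of_ne hne' with hlt4 | hgt4
          · -- next step is of type II: after it every `f` is good: final state (α − β, 2β − α, 2a + b, a + b, 2c + d, c + d)
            have hβ'' : 0 < β - (α - β) := sub_pos.mpr hlt4
            refine ⟨a + (a + b), a + b, c + (c + d), c + d, α - β, β - (α - β), hα', hβ'', by omega, by omega,
              by omega, by omega, ?_, ?_, ?_, ?_⟩
            · have e : (a + (a + b)) * (c + d) - (a + b) * (c + (c + d)) = a * d - b * c := by ring
              rw [e]; exact hdet
            · rw [h1]; push_cast; ring
            · rw [h2]; push_cast; ring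
            · intro f hf
              by_cases hg : 0 < f.1 * a + f.2 * c ∧ 0 < f.1 * b + f.2 * d
              · constructor <;> nlinarith [hg.1, hg.2]
              · have hx0 := hwait f hf hg
                have hy : 0 < f.1 * b + f.2 * d := by
                  have := hvf f hf
                  have hx0' : ((f.1 * a + f.2 * c : ℤ) : ℝ) = 0 := by exact_mod_cast hx0
                  rw [hx0', zero_mul, zero_add] at this
                  have hy' : (0 : ℝ) < ((f.1 * b + f.2 * d : ℤ) : ℝ) := (pos_iff_pos_of_mul_pos this).mpr hβ
                  exact_mod_cast hy'
                constructor <;> nlinarith [hy, hx0]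
          · -- next step is again of type I: inner induction hypothesis (run-length bound drops)
            refine ihR (α - β) β a (a + b) c (c + d) hα' hβ ha (by omega) hc (by omega) hdet' h1' h2'
              (heq2 ▸ hMes) ?_
            have hq1 : ⌊β / (α - β)⌋₊ = 0 := by
              rw [Nat.floor_eq_zero, div_lt_one hα']; exact hgt4
            have hq2 : ⌊(α - β) / β⌋₊ = ⌊α / β⌋₊ - 1 := by
              rw [sub_div, div_self hβ.ne', Nat.floor_sub_one]
            have hq3 : ⌊β / α⌋₊ = 0 := by
              rw [Nat.floor_eq_zero, div_lt_one hα]; exact hgt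
            omega

/-! ## The refinement theorems -/

/-- **Positive unimodular refinement around an irrational ray (positive quadrant).**  `ω = (ω₁, ω₂)`, `ω₁, ω₂ > 0`, `ℚ`-independent;
`F` finite set of integral forms positive at `ω`.  Then `ℤ²` has a basis `(a, c), (b, d)` with non-negative entries, `ad − bc = ±1`,
`ω = α (a, c) + β (b, d)` with `α, β > 0`, and every `f ∈ F` positive on both basis vectors. -/
theorem exists_unimodular_positive_refinement (ω₁ ω₂ : ℝ) (hω₁ : 0 < ω₁) (hω₂ : 0 < ω₂)
    (hind : ∀ u v : ℤ, (u : ℝ) * ω₁ + v * ω₂ = 0 → u = 0 ∧ v = 0)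
    (F : Finset (ℤ × ℤ)) (hF : ∀ f ∈ F, 0 < (f.1 : ℝ) * ω₁ + f.2 * ω₂) :
    ∃ (a b c d : ℤ) (α β : ℝ), 0 < α ∧ 0 < β ∧ 0 ≤ a ∧ 0 ≤ b ∧ 0 ≤ c ∧ 0 ≤ d ∧
      (a * d - b * c = 1 ∨ a * d - b * c = -1) ∧ ω₁ = a * α + b * β ∧ ω₂ = c * α + d * β ∧
      ∀ f ∈ F, 0 < f.1 * a + f.2 * c ∧ 0 < f.1 * b + f.2 * d :=
  refine_aux ω₁ ω₂ hind F hF _ _ ω₁ ω₂ 1 0 0 1 hω₁ hω₂ (by norm_num) le_rfl le_rfl (by norm_num) (by norm_num)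
    (by push_cast; ring) (by push_cast; ring) le_rfl le_rfl

/-- **Positive unimodular refinement around an irrational ray (any quadrant).**  Same, for `ω` with `ℚ`-independent coordinates of any
signs (the basis vectors then have entries of the corresponding signs; only `det = ±1` is recorded). -/
theorem exists_unimodular_positive_refinement' (ω₁ ω₂ : ℝ)
    (hind : ∀ u v : ℤ, (u : ℝ) * ω₁ + v * ω₂ = 0 → u = 0 ∧ v = 0)
    (F : Finset (ℤ × ℤ)) (hF : ∀ f ∈ F, 0 < (f.1 : ℝ) * ω₁ + f.2 * ω₂) :
    ∃ (a b c d : ℤ) (α β : ℝ), 0 < α ∧ 0 < β ∧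
      (a * d - b * c = 1 ∨ a * d - b * c = -1) ∧ ω₁ = a * α + b * β ∧ ω₂ = c * α + d * β ∧
      ∀ f ∈ F, 0 < f.1 * a + f.2 * c ∧ 0 < f.1 * b + f.2 * d := by
  classical
  -- signs
  have hω₁ : ω₁ ≠ 0 := by
    intro h; have := (hind 1 0 (by rw [h]; simp)).1; exact one_ne_zero this
  have hω₂ : ω₂ ≠ 0 := by
    intro h; have := (hind 0 1 (by rw [h]; simp)).2; exact one_ne_zero this
  obtain ⟨s₁, hs₁, hs₁ω⟩ : ∃ s₁ : ℤ, s₁ * s₁ = 1 ∧ 0 < (s₁ : ℝ) * ω₁ := by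
    rcases lt_or_gt_of_ne hω₁ with h | h
    · exact ⟨-1, by norm_num, by push_cast; nlinarith⟩
    · exact ⟨1, by norm_num, by push_cast; nlinarith⟩
  obtain ⟨s₂, hs₂, hs₂ω⟩ : ∃ s₂ : ℤ, s₂ * s₂ = 1 ∧ 0 < (s₂ : ℝ) * ω₂ := by
    rcases lt_or_gt_of_ne hω₂ with h | h
    · exact ⟨-1, by norm_num, by push_cast; nlinarith⟩
    · exact ⟨1, by norm_num, by push_cast; nlinarith⟩
  have hs₁r : (s₁ : ℝ) * s₁ = 1 := by exact_mod_cast hs₁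
  have hs₂r : (s₂ : ℝ) * s₂ = 1 := by exact_mod_cast hs₂
  -- twisted data
  have hind' : ∀ u v : ℤ, (u : ℝ) * (s₁ * ω₁) + v * (s₂ * ω₂) = 0 → u = 0 ∧ v = 0 := by
    intro u v h
    have h' : ((u * s₁ : ℤ) : ℝ) * ω₁ + ((v * s₂ : ℤ) : ℝ) * ω₂ = 0 := by push_cast; linarith [h]
    obtain ⟨h1, h2⟩ := hind _ _ h'
    constructor
    · have := congrArg (· * s₁) h1; simp only [mul_assoc, hs₁, mul_one, zero_mul] at this; exact this
    · have := congrArg (· * s₂) h2; simp only [mul_assoc, hs₂, mul_one, zero_mul] at this; exact this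
  let g : ℤ × ℤ → ℤ × ℤ := fun f => (f.1 * s₁, f.2 * s₂)
  have hF' : ∀ f' ∈ F.image g, 0 < (f'.1 : ℝ) * (s₁ * ω₁) + f'.2 * (s₂ * ω₂) := by
    intro f' hf'
    obtain ⟨f, hf, rfl⟩ := Finset.mem_image.mp hf'
    have := hF f hf
    simp only [g]; push_cast
    have e1 : (f.1 : ℝ) * s₁ * (s₁ * ω₁) = f.1 * ω₁ := by
      rw [mul_assoc, ← mul_assoc (s₁ : ℝ), hs₁r, one_mul]
    have e2 : (f.2 : ℝ) * s₂ * (s₂ * ω₂) = f.2 * ω₂ := by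
      rw [mul_assoc, ← mul_assoc (s₂ : ℝ), hs₂r, one_mul]
    rw [e1, e2]; exact this
  obtain ⟨a, b, c, d, α, β, hα, hβ, -, -, -, -, hdet, h1, h2, hgood⟩ :=
    exists_unimodular_positive_refinement (s₁ * ω₁) (s₂ * ω₂) hs₁ω hs₂ω hind' (F.image g) hF'
  refine ⟨s₁ * a, s₁ * b, s₂ * c, s₂ * d, α, β, hα, hβ, ?_, ?_, ?_, ?_⟩
  · have e : s₁ * a * (s₂ * d) - s₁ * b * (s₂ * c) = (s₁ * s₂) * (a * d - b * c) := by ring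
    have h1' : s₁ = 1 ∨ s₁ = -1 := Int.eq_one_or_neg_one_of_mul_eq_one hs₁
    have h2' : s₂ = 1 ∨ s₂ = -1 := Int.eq_one_or_neg_one_of_mul_eq_one hs₂
    rw [e]
    rcases h1' with rfl | rfl <;> rcases h2' with rfl | rfl <;> rcases hdet with h | h <;> simp [h]
  · calc ω₁ = (s₁ : ℝ) * (s₁ * ω₁) := by rw [← mul_assoc, hs₁r, one_mul]
      _ = _ := by rw [h1]; push_cast; ring
  · calc ω₂ = (s₂ : ℝ) * (s₂ * ω₂) := by rw [← mul_assoc, hs₂r, one_mul]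
      _ = _ := by rw [h2]; push_cast; ring
  · intro f hf
    have := hgood (g f) (Finset.mem_image_of_mem g hf)
    simp only [g] at this
    constructor <;> nlinarith [this.1, this.2]

/-! ## The lexicographic variant (CLASS (C): composite rank two) — a RATIONAL first weight: primitive vector + Bezout + shear

For a composite rank-two valuation the value group has rational rank two, one per level, so the weight map on the plane `W* ∩ N′ ≅ ℤ²`
is `n ↦ (⟨n, w¹⟩, ⟨n, w²⟩)` LEXICOGRAPHICALLY with `w¹, w² ∈ ℤ²` independent (`w¹` = coarse weights, a RATIONAL ray).  The required cone is
then elementary: `n₁` := the primitive vector on the ray of `w¹`, `n₂` := a Bezout complement with `w²`-coordinate `b₂ > 0`, sheared along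
`n₁` until every `f ∈ F` is non-negative on it.  Conclusion: `w¹ = g·n₁` (`g > 0`), `w² = b₁ n₁ + b₂ n₂` (`b₂ > 0`) — so the dual monomials
have lex-values `(g, b₁) > 0` and `(0, b₂) > 0` — and `⟨f, n₁⟩, ⟨f, n₂⟩ ≥ 0` for every `f` of lex-positive value. -/

/-- **Unimodular refinement, lexicographic weights (class (C)).** -/
theorem exists_unimodular_lex_refinement (p₁ p₂ q₁ q₂ : ℤ) (hdet : p₁ * q₂ - p₂ * q₁ ≠ 0)
    (F : Finset (ℤ × ℤ))
    (hF : ∀ f ∈ F, 0 < f.1 * p₁ + f.2 * p₂ ∨ (f.1 * p₁ + f.2 * p₂ = 0 ∧ 0 < f.1 * q₁ + f.2 * q₂)) :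
    ∃ (a b c d g b₁ b₂ : ℤ), (a * d - b * c = 1 ∨ a * d - b * c = -1) ∧ 0 < g ∧ 0 < b₂ ∧
      p₁ = g * a ∧ p₂ = g * c ∧ q₁ = b₁ * a + b₂ * b ∧ q₂ = b₁ * c + b₂ * d ∧
      ∀ f ∈ F, 0 ≤ f.1 * a + f.2 * c ∧ 0 ≤ f.1 * b + f.2 * d := by
  -- the primitive vector `(a, c)` on the ray of `w¹ = (p₁, p₂)`
  have hp : p₁ ≠ 0 ∨ p₂ ≠ 0 := by
    by_contra h
    push Not at h
    obtain ⟨rfl, rfl⟩ := h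
    exact hdet (by ring)
  have hg : 0 < Int.gcd p₁ p₂ := Int.gcd_pos_iff.mpr hp
  set g : ℤ := (Int.gcd p₁ p₂ : ℤ) with hgdef
  have hg' : (0 : ℤ) < g := by rw [hgdef]; exact_mod_cast hg
  set a : ℤ := p₁ / g with hadef
  set c : ℤ := p₂ / g with hcdef
  have hpa : p₁ = g * a := (Int.mul_ediv_cancel' (Int.gcd_dvd_left p₁ p₂)).symm
  have hpc : p₂ = g * c := (Int.mul_ediv_cancel' (Int.gcd_dvd_right p₁ p₂)).symm
  have hac : Int.gcd a c = 1 := Int.gcd_div_gcd_div_gcd hg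
  -- Bezout complement `(b₀, d₀)` with `a d₀ − b₀ c = 1`
  obtain ⟨x, y, hxy⟩ : ∃ x y : ℤ, a * x + c * y = 1 := by
    refine ⟨Int.gcdA a c, Int.gcdB a c, ?_⟩
    have := Int.gcd_eq_gcd_ab a c
    rw [hac] at this
    exact_mod_cast this.symm
  set b₀ : ℤ := -y with hb₀
  set d₀ : ℤ := x with hd₀
  have hdet₀ : a * d₀ - b₀ * c = 1 := by rw [hb₀, hd₀]; linarith [hxy]
  -- coordinates of `w² = (q₁, q₂)` in the basis `(a,c), (b₀,d₀)`
  set β₁ : ℤ := q₁ * d₀ - q₂ * b₀ with hβ₁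
  set β₂ : ℤ := a * q₂ - c * q₁ with hβ₂
  have hq₁ : q₁ = β₁ * a + β₂ * b₀ := by
    have : q₁ * (a * d₀ - b₀ * c) = β₁ * a + β₂ * b₀ := by rw [hβ₁, hβ₂]; ring
    rw [hdet₀, mul_one] at this; exact this
  have hq₂ : q₂ = β₁ * c + β₂ * d₀ := by
    have : q₂ * (a * d₀ - b₀ * c) = β₁ * c + β₂ * d₀ := by rw [hβ₁, hβ₂]; ring
    rw [hdet₀, mul_one] at this; exact this
  have hβ₂0 : β₂ ≠ 0 := by
    intro h0
    apply hdet
    rw [hpa, hpc]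
    have : g * a * q₂ - g * c * q₁ = g * β₂ := by rw [hβ₂]; ring
    rw [this, h0, mul_zero]
  -- sign fix: `s = ±1` with `s β₂ > 0`
  obtain ⟨s, hs, hsβ⟩ : ∃ s : ℤ, (s = 1 ∨ s = -1) ∧ 0 < s * β₂ := by
    rcases lt_or_gt_of_ne hβ₂0 with h | h
    · exact ⟨-1, Or.inr rfl, by linarith⟩
    · exact ⟨1, Or.inl rfl, by linarith⟩
  have hss : s * s = 1 := by rcases hs with rfl | rfl <;> norm_num
  -- shear amount
  set t : ℤ := ∑ f ∈ F, |f.1 * (s * b₀) + f.2 * (s * d₀)| with ht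
  have ht0 : ∀ f ∈ F, |f.1 * (s * b₀) + f.2 * (s * d₀)| ≤ t := fun f hf =>
    Finset.single_le_sum (f := fun f : ℤ × ℤ => |f.1 * (s * b₀) + f.2 * (s * d₀)|) (fun _ _ => abs_nonneg _) hf
  -- the basis: n₁ = (a, c), n₂ = s (b₀, d₀) + t (a, c)
  refine ⟨a, s * b₀ + t * a, c, s * d₀ + t * c, g, β₁ - t * s * β₂, s * β₂, ?_, hg', hsβ, hpa, hpc, ?_, ?_, ?_⟩
  · have e : a * (s * d₀ + t * c) - (s * b₀ + t * a) * c = s * (a * d₀ - b₀ * c) := by ring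
    rw [e, hdet₀, mul_one]; exact hs
  · rw [hq₁]
    have : β₂ * b₀ = s * s * β₂ * b₀ := by rw [hss, one_mul]
    rw [this]; ring
  · rw [hq₂]
    have : β₂ * d₀ = s * s * β₂ * d₀ := by rw [hss, one_mul]
    rw [this]; ring
  · intro f hf
    have hfn₁ : g * (f.1 * a + f.2 * c) = f.1 * p₁ + f.2 * p₂ := by rw [hpa, hpc]; ring
    rcases hF f hf with hpos | ⟨hzero, hpos2⟩
    · -- `f(w¹) > 0`: `f(n₁) ≥ 1` and the shear dominates
      have h1 : 0 < f.1 * a + f.2 * c := by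
        rw [← hfn₁] at hpos
        exact (pos_iff_pos_of_mul_pos hpos).mp hg'
      refine ⟨h1.le, ?_⟩
      have e : f.1 * (s * b₀ + t * a) + f.2 * (s * d₀ + t * c) =
          (f.1 * (s * b₀) + f.2 * (s * d₀)) + t * (f.1 * a + f.2 * c) := by ring
      rw [e]
      have h2 := ht0 f hf
      have h3 : -(f.1 * (s * b₀) + f.2 * (s * d₀)) ≤ t := le_trans (neg_le_abs _) h2
      have h4 : t ≤ t * (f.1 * a + f.2 * c) := by
        have htnn : 0 ≤ t := le_trans (abs_nonneg _) h2
        nlinarith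
      linarith
    · -- `f(w¹) = 0 < f(w²)`: `f(n₁) = 0` and `b₂ f(n₂) = f(w²) > 0`
      have h1 : f.1 * a + f.2 * c = 0 := by
        rw [← hfn₁] at hzero
        rcases mul_eq_zero.mp hzero with h | h
        · exact absurd h hg'.ne'
        · exact h
      refine ⟨h1.symm.le, ?_⟩
      have e : f.1 * (s * b₀ + t * a) + f.2 * (s * d₀ + t * c) = s * (f.1 * b₀ + f.2 * d₀) + t * (f.1 * a + f.2 * c) := by ring
      rw [e, h1, mul_zero, add_zero]
      have hw2 : f.1 * q₁ + f.2 * q₂ = β₁ * (f.1 * a + f.2 * c) + β₂ * (f.1 * b₀ + f.2 * d₀) := by rw [hq₁, hq₂]; ring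
      rw [hw2, h1, mul_zero, zero_add] at hpos2
      -- `0 < β₂ * X` and `0 < s β₂` ⇒ `0 < s * X`... via `(s β₂) (s X) = β₂ X (s² = 1)`
      have : 0 < (s * β₂) * (s * (f.1 * b₀ + f.2 * d₀)) := by
        have e2 : (s * β₂) * (s * (f.1 * b₀ + f.2 * d₀)) = (s * s) * (β₂ * (f.1 * b₀ + f.2 * d₀)) := by ring
        rw [e2, hss, one_mul]; exact hpos2
      exact le_of_lt ((pos_iff_pos_of_mul_pos this).mp hsβ)

/-! ## (rev 4) The toric lemma in a rank-3 lattice, class (B), `ρ = 2` — change of basis adapted to the kernel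

Given a `ℤ`-basis `(e₀, e₁, e₂)` of a lattice `L` ADAPTED TO THE KERNEL of the (real) weight `φ` — `φ(e₂) = 0`, `φ(e₀), φ(e₁)` rationally
independent (this adapted basis is the Smith-normal-form bookkeeping left to the port: `ker φ` is saturated of rank one) — and a finite
`F ⊂ L` of positive weight, there is a new basis `(m₁, m₂, e₂)` (unimodular change in the `(e₀, e₁)`-plane) with `φ(m₁), φ(m₂) > 0` and every
`f ∈ F` having POSITIVE `m₁`- and `m₂`-coordinates: the dual monomials `u₁, u₂` have positive value, `u₃` value zero, and every piece
`g_{j,ab}` is a monomial in `u₁, u₂, u₃^{±1}` — memo §3 (i)–(iv) in primal form ((iii) is then automatic from (ii)). -/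

/-- **TORIC LEMMA, class (B), `ρ = 2`, lattice form.** -/
theorem exists_adapted_basis_rank3 {L : Type} [AddCommGroup L] (e : Module.Basis (Fin 3) ℤ L) (φ : L →+ ℝ)
    (hker : φ (e 2) = 0) (hind : ∀ u v : ℤ, (u : ℝ) * φ (e 0) + v * φ (e 1) = 0 → u = 0 ∧ v = 0)
    (F : Finset L) (hF : ∀ f ∈ F, 0 < φ f) :
    ∃ (m₁ m₂ : L) (a b c d : ℤ), (a * d - b * c = 1 ∨ a * d - b * c = -1) ∧
      e 0 = a • m₁ + b • m₂ ∧ e 1 = c • m₁ + d • m₂ ∧ 0 < φ m₁ ∧ 0 < φ m₂ ∧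
      ∀ f ∈ F, f = (e.repr f 0 * a + e.repr f 1 * c) • m₁ + (e.repr f 0 * b + e.repr f 1 * d) • m₂ + e.repr f 2 • e 2 ∧
        0 < e.repr f 0 * a + e.repr f 1 * c ∧ 0 < e.repr f 0 * b + e.repr f 1 * d := by
  classical
  -- every `f` in coordinates
  have hrepr : ∀ f : L, f = e.repr f 0 • e 0 + e.repr f 1 • e 1 + e.repr f 2 • e 2 := by
    intro f
    conv_lhs => rw [← e.sum_repr f]
    rw [Fin.sum_univ_three]
  have hφ : ∀ f : L, φ f = (e.repr f 0 : ℝ) * φ (e 0) + (e.repr f 1 : ℝ) * φ (e 1) := by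
    intro f
    conv_lhs => rw [hrepr f]
    rw [map_add, map_add, map_zsmul, map_zsmul, map_zsmul, hker, smul_zero, add_zero, zsmul_eq_mul, zsmul_eq_mul]
  -- the plane problem
  obtain ⟨a, b, c, d, α, β, hα, hβ, hdet, h0, h1, hpos⟩ :=
    exists_unimodular_positive_refinement' (φ (e 0)) (φ (e 1)) hind (F.image fun f => (e.repr f 0, e.repr f 1))
      (by
        intro g hg
        obtain ⟨f, hf, rfl⟩ := Finset.mem_image.mp hg
        simpa [hφ f] using hF f hf)
  -- the new basis vectors (inverse of the unimodular matrix, sign-corrected)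
  obtain ⟨ε, hε, hεdet⟩ : ∃ ε : ℤ, (ε = 1 ∨ ε = -1) ∧ ε * (a * d - b * c) = 1 := by
    rcases hdet with h | h
    · exact ⟨1, Or.inl rfl, by rw [h]; ring⟩
    · exact ⟨-1, Or.inr rfl, by rw [h]; ring⟩
  refine ⟨ε • (d • e 0 - b • e 1), ε • (-c • e 0 + a • e 1), a, b, c, d, hdet, ?_, ?_, ?_, ?_, ?_⟩
  · -- `e 0 = a m₁ + b m₂`
    have : a • (ε • (d • e 0 - b • e 1)) + b • (ε • (-c • e 0 + a • e 1)) = (ε * (a * d - b * c)) • e 0 := by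
      module
    rw [this, hεdet, one_smul]
  · have : c • (ε • (d • e 0 - b • e 1)) + d • (ε • (-c • e 0 + a • e 1)) = (ε * (a * d - b * c)) • e 1 := by
      module
    rw [this, hεdet, one_smul]
  · -- `φ m₁ = α`
    have : φ (ε • (d • e 0 - b • e 1)) = (ε * (a * d - b * c) : ℤ) * α := by
      rw [map_zsmul, map_sub, map_zsmul, map_zsmul, h0, h1]
      simp only [zsmul_eq_mul, Int.cast_mul, Int.cast_sub]
      ring
    rw [this, hεdet]; simpa using hα
  · have : φ (ε • (-c • e 0 + a • e 1)) = (ε * (a * d - b * c) : ℤ) * β := by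
      rw [map_zsmul, map_add, map_zsmul, map_zsmul, h0, h1]
      simp only [zsmul_eq_mul, Int.cast_mul, Int.cast_sub, Int.cast_neg]
      ring
    rw [this, hεdet]; simpa using hβ
  · intro f hf
    have hg := hpos (e.repr f 0, e.repr f 1) (Finset.mem_image.mpr ⟨f, hf, rfl⟩)
    refine ⟨?_, hg.1, hg.2⟩
    have key : (e.repr f 0 * a + e.repr f 1 * c) • (ε • (d • e 0 - b • e 1)) +
        (e.repr f 0 * b + e.repr f 1 * d) • (ε • (-c • e 0 + a • e 1)) =
        (ε * (a * d - b * c) * e.repr f 0) • e 0 + (ε * (a * d - b * c) * e.repr f 1) • e 1 := by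
      module
    rw [key, hεdet, one_mul, one_mul]
    exact hrepr f

/-! ## (rev 5) Class (B) with values in any ARCHIMEDEAN ordered group (the port's value group, no `ℝ` needed upstream)

Class (B) means the valuation has rank one, i.e. its value group is archimedean (`Valuation.nonempty_rankOne_iff_mulArchimedean`); the
weight `φ` of §3 then takes values in an archimedean linearly ordered additive group `W` (e.g. `Additive Γˣ`), which embeds into `ℝ` by an
injective ordered homomorphism (Hölder; Mathlib `Archimedean.exists_orderAddMonoidHom_real_injective`).  So the lattice toric lemma holds
verbatim with `φ : L →+ W`. -/

/-- **TORIC LEMMA, class (B), `ρ = 2`, lattice form, archimedean values.** -/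
theorem exists_adapted_basis_rank3_archimedean {L : Type} [AddCommGroup L] {W : Type} [AddCommGroup W] [LinearOrder W]
    [IsOrderedAddMonoid W] [Archimedean W] (e : Module.Basis (Fin 3) ℤ L) (φ : L →+ W)
    (hker : φ (e 2) = 0) (hind : ∀ u v : ℤ, u • φ (e 0) + v • φ (e 1) = 0 → u = 0 ∧ v = 0)
    (F : Finset L) (hF : ∀ f ∈ F, 0 < φ f) :
    ∃ (m₁ m₂ : L) (a b c d : ℤ), (a * d - b * c = 1 ∨ a * d - b * c = -1) ∧
      e 0 = a • m₁ + b • m₂ ∧ e 1 = c • m₁ + d • m₂ ∧ 0 < φ m₁ ∧ 0 < φ m₂ ∧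
      ∀ f ∈ F, f = (e.repr f 0 * a + e.repr f 1 * c) • m₁ + (e.repr f 0 * b + e.repr f 1 * d) • m₂ + e.repr f 2 • e 2 ∧
        0 < e.repr f 0 * a + e.repr f 1 * c ∧ 0 < e.repr f 0 * b + e.repr f 1 * d := by
  obtain ⟨ι, hι⟩ := Archimedean.exists_orderAddMonoidHom_real_injective W
  have hι0 : ∀ w : W, ι w = 0 ↔ w = 0 := fun w => by
    constructor
    · intro h; exact hι (by rw [h, map_zero])
    · intro h; rw [h, map_zero]
  have hιpos : ∀ w : W, 0 < ι w ↔ 0 < w := fun w => by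
    constructor
    · intro h
      by_contra hle
      have hmono : ι w ≤ ι 0 := OrderHomClass.mono ι (not_lt.mp hle)
      rw [map_zero] at hmono
      exact absurd h (not_lt.mpr hmono)
    · intro h
      have hmono : ι 0 ≤ ι w := OrderHomClass.mono ι h.le
      rw [map_zero] at hmono
      rcases hmono.lt_or_eq with hlt | heq
      · exact hlt
      · exact absurd ((hι0 w).mp heq.symm) h.ne'
  let ψ : L →+ ℝ := (ι : W →+ ℝ).comp φ
  have hψ : ∀ x : L, ψ x = ι (φ x) := fun x => rfl
  have hkerψ : ψ (e 2) = 0 := by rw [hψ, hker, map_zero]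
  have hindψ : ∀ u v : ℤ, (u : ℝ) * ψ (e 0) + v * ψ (e 1) = 0 → u = 0 ∧ v = 0 := by
    intro u v huv
    apply hind u v
    rw [← hι0]
    rw [map_add, map_zsmul, map_zsmul, zsmul_eq_mul, zsmul_eq_mul]
    simpa [hψ] using huv
  have hFψ : ∀ f ∈ F, 0 < ψ f := fun f hf => by rw [hψ, hιpos]; exact hF f hf
  obtain ⟨m₁, m₂, a, b, c, d, hdet, h0, h1, hm₁, hm₂, hcoord⟩ := exists_adapted_basis_rank3 e ψ hkerψ hindψ F hFψ
  refine ⟨m₁, m₂, a, b, c, d, hdet, h0, h1, ?_, ?_, hcoord⟩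
  · rw [hψ, hιpos] at hm₁; exact hm₁
  · rw [hψ, hιpos] at hm₂; exact hm₂

/-! ## (rev 6) The Smith-normal-form step: a basis ADAPTED TO THE KERNEL exists (class (B), `ρ = 2`)

For a rank-3 lattice `L` and an additive `φ : L → W` (`W` torsion-free, e.g. any linearly ordered additive group) whose kernel has rank exactly one
— some non-zero `x` with `φ x = 0`, and any two kernel elements dependent — there is a `ℤ`-basis `(e₀, e₁, e₂)` of `L` with `φ(e₂) = 0` and
`φ(e₀), φ(e₁)` independent; this is the input of `exists_adapted_basis_rank3(_archimedean)`.  Proof: Smith normal form of `ker φ ≤ L`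
(Mathlib `Submodule.smithNormalForm`): `bN i = a_i • bM (f i)`, `a_i ≠ 0`, hence `bM (f i) ∈ ker φ` (`W` torsion-free — the kernel is
saturated); exactly one `i` (two would be independent kernel vectors, none would make the kernel zero); re-index so that it sits at `2`. -/

theorem exists_kernel_adapted_basis {L : Type} [AddCommGroup L] (b : Module.Basis (Fin 3) ℤ L) {W : Type} [AddCommGroup W]
    [NoZeroSMulDivisors ℤ W] (φ : L →+ W) (h1 : ∃ x : L, x ≠ 0 ∧ φ x = 0)
    (h2 : ∀ x y : L, φ x = 0 → φ y = 0 → ∃ s t : ℤ, (s ≠ 0 ∨ t ≠ 0) ∧ s • x + t • y = 0) :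
    ∃ e : Module.Basis (Fin 3) ℤ L, φ (e 2) = 0 ∧ ∀ u v : ℤ, u • φ (e 0) + v • φ (e 1) = 0 → u = 0 ∧ v = 0 := by
  classical
  let N : Submodule ℤ L := LinearMap.ker φ.toIntLinearMap
  have hN : ∀ x : L, x ∈ N ↔ φ x = 0 := fun x => by
    simp only [N, LinearMap.mem_ker, AddMonoidHom.coe_toIntLinearMap]
  obtain ⟨n, snf⟩ := Submodule.smithNormalForm b N
  -- the kernel is saturated: each `bM (f i)` lies in it
  have hfi : ∀ i : Fin n, φ (snf.bM (snf.f i)) = 0 := by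
    intro i
    have hmem : ((snf.bN i : N) : L) ∈ N := (snf.bN i).2
    rw [hN, snf.snf i, map_zsmul] at hmem
    have hai : snf.a i ≠ 0 := by
      intro h0
      have h0' : ((snf.bN i : N) : L) = 0 := by rw [snf.snf i, h0, zero_smul]
      exact snf.bN.ne_zero i (Subtype.ext h0')
    exact (smul_eq_zero.mp hmem).resolve_left hai
  -- two distinct `f i`, `f j` would be independent kernel vectors
  have hn2 : ∀ i j : Fin n, i = j := by
    intro i j
    by_contra hij
    obtain ⟨s, t, hst, hrel⟩ := h2 _ _ (hfi i) (hfi j)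
    have hfij : snf.f i ≠ snf.f j := fun h => hij (snf.f.injective h)
    have hci := congrArg (fun x => snf.bM.repr x (snf.f i)) hrel
    have hcj := congrArg (fun x => snf.bM.repr x (snf.f j)) hrel
    simp only [map_add, map_zsmul, Module.Basis.repr_self, Finsupp.coe_add, Finsupp.coe_smul, Pi.add_apply,
      Pi.smul_apply, Finsupp.single_apply, map_zero, Finsupp.coe_zero, Pi.zero_apply] at hci hcj
    simp [hfij, hfij.symm] at hci hcj
    rcases hst with hs | ht
    · exact hs hci
    · exact ht hcj
  -- and `n = 0` would make the kernel trivial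
  have hn0 : n ≠ 0 := by
    intro hn
    subst hn
    obtain ⟨x, hx0, hx⟩ := h1
    have hxN : x ∈ N := (hN x).mpr hx
    have hsum := snf.bN.sum_repr ⟨x, hxN⟩
    rw [Finset.univ_eq_empty, Finset.sum_empty] at hsum
    exact hx0 (by simpa using congrArg Subtype.val hsum.symm)
  -- so `n = 1`
  obtain ⟨i₀⟩ : Nonempty (Fin n) := Fin.pos_iff_nonempty.mp (Nat.pos_of_ne_zero hn0)
  -- re-index: the kernel vector goes to position `2`
  let σ : Fin 3 ≃ Fin 3 := Equiv.swap (snf.f i₀) 2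
  refine ⟨snf.bM.reindex σ, ?_, ?_⟩
  · rw [Module.Basis.reindex_apply]
    have : σ.symm 2 = snf.f i₀ := by
      rw [Equiv.symm_apply_eq]
      exact (Equiv.swap_apply_left _ _).symm
    rw [this]
    exact hfi i₀
  · intro u v huv
    -- `y := u e₀ + v e₁ ∈ ker φ = ℤ bN i₀ = ℤ a • bM (f i₀)`
    have hy : φ (u • snf.bM.reindex σ 0 + v • snf.bM.reindex σ 1) = 0 := by
      rw [map_add, map_zsmul, map_zsmul, huv]
    have hyN : u • snf.bM.reindex σ 0 + v • snf.bM.reindex σ 1 ∈ N := (hN _).mpr hy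
    have hsum := snf.bN.sum_repr ⟨_, hyN⟩
    have huniv : (Finset.univ : Finset (Fin n)) = {i₀} := by
      ext j; simp [hn2 j i₀]
    rw [huniv, Finset.sum_singleton] at hsum
    have hval := congrArg Subtype.val hsum
    simp only [Submodule.coe_smul_of_tower] at hval
    rw [snf.snf i₀] at hval
    -- compare coordinates at `0` and `1` in the basis `bM.reindex σ`
    have hσ0 : σ.symm 0 ≠ snf.f i₀ := by
      rw [Ne, Equiv.symm_apply_eq]
      intro h
      have := Equiv.swap_apply_left (snf.f i₀) (2 : Fin 3)
      rw [this] at h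
      exact absurd h (by decide)
    have hσ1 : σ.symm 1 ≠ snf.f i₀ := by
      rw [Ne, Equiv.symm_apply_eq]
      intro h
      have := Equiv.swap_apply_left (snf.f i₀) (2 : Fin 3)
      rw [this] at h
      exact absurd h (by decide)
    have hc0 := congrArg (fun x => (snf.bM.reindex σ).repr x 0) hval
    have hc1 := congrArg (fun x => (snf.bM.reindex σ).repr x 1) hval
    simp only [map_add, map_zsmul, Module.Basis.repr_self, Finsupp.coe_add, Finsupp.coe_smul, Pi.add_apply,
      Pi.smul_apply, Finsupp.single_apply, Module.Basis.repr_reindex_apply, smul_eq_mul] at hc0 hc1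
    simp [Ne.symm hσ0, Ne.symm hσ1] at hc0 hc1
    exact ⟨hc0.symm, hc1.symm⟩

/-! ## (rev 6) The rational-ray case `ρ = 1` (kernel of rank two): adapted basis, and §3 (i)–(iv) are automatic

If `ker φ` has rank two (two independent kernel vectors; `φ ≠ 0`), Smith normal form gives a basis with two kernel vectors; the third vector
`e_{i₀}` carries all the weight: `φ f = (e.repr f i₀) • φ(e_{i₀})`, so after a sign every `f` of positive weight has a positive
`i₀`-coordinate — the toric chart is `u_{i₀}` (value `> 0`), `u_i` (`i ≠ i₀`, value `0`, units `u_i^{±1}`), no refinement needed. -/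

lemma fin3_third (i i₀ : Fin 3) (h : i ≠ i₀) : ∃ k : Fin 3, k ≠ i ∧ k ≠ i₀ := by
  revert i i₀; decide

lemma fin3_cases (i i₀ k : Fin 3) (hi : i ≠ i₀) (hk : k ≠ i) (hk₀ : k ≠ i₀) : ∀ j : Fin 3, j = i ∨ j = i₀ ∨ j = k := by
  revert i i₀ k; decide

theorem exists_kernel_adapted_basis_of_rank_two_ker {L : Type} [AddCommGroup L] (b : Module.Basis (Fin 3) ℤ L) {W : Type}
    [AddCommGroup W] [NoZeroSMulDivisors ℤ W] (φ : L →+ W) (h0 : ∃ x : L, φ x ≠ 0)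
    (h2 : ∃ x y : L, φ x = 0 ∧ φ y = 0 ∧ ∀ s t : ℤ, s • x + t • y = 0 → s = 0 ∧ t = 0) :
    ∃ (e : Module.Basis (Fin 3) ℤ L) (i₀ : Fin 3), φ (e i₀) ≠ 0 ∧ (∀ i, i ≠ i₀ → φ (e i) = 0) ∧
      ∀ f : L, φ f = e.repr f i₀ • φ (e i₀) := by
  classical
  let N : Submodule ℤ L := LinearMap.ker φ.toIntLinearMap
  have hN : ∀ x : L, x ∈ N ↔ φ x = 0 := fun x => by
    simp only [N, LinearMap.mem_ker, AddMonoidHom.coe_toIntLinearMap]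
  obtain ⟨n, snf⟩ := Submodule.smithNormalForm b N
  have hfi : ∀ i : Fin n, φ (snf.bM (snf.f i)) = 0 := by
    intro i
    have hmem : ((snf.bN i : N) : L) ∈ N := (snf.bN i).2
    rw [hN, snf.snf i, map_zsmul] at hmem
    have hai : snf.a i ≠ 0 := by
      intro h0'
      have h0'' : ((snf.bN i : N) : L) = 0 := by rw [snf.snf i, h0', zero_smul]
      exact snf.bN.ne_zero i (Subtype.ext h0'')
    exact (smul_eq_zero.mp hmem).resolve_left hai
  -- some index is NOT in the range of `f` (else `φ = 0`)
  obtain ⟨i₀, hi₀⟩ : ∃ i₀ : Fin 3, i₀ ∉ Set.range snf.f := by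
    by_contra hall
    push Not at hall
    obtain ⟨x, hx⟩ := h0
    apply hx
    have hrepr : x = ∑ i, snf.bM.repr x i • snf.bM i := (snf.bM.sum_repr x).symm
    rw [hrepr, map_sum]
    refine Finset.sum_eq_zero fun i _ => ?_
    obtain ⟨j, hj⟩ := hall i
    rw [map_zsmul, ← hj, hfi j, smul_zero]
  -- every other index IS in the range of `f` (else two coordinates vanish on `N`, contradicting rank two)
  have hother : ∀ i, i ≠ i₀ → i ∈ Set.range snf.f := by
    intro i hi
    by_contra hi'
    obtain ⟨x, y, hx, hy, hind⟩ := h2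
    have hxN : x ∈ N := (hN x).mpr hx
    have hyN : y ∈ N := (hN y).mpr hy
    -- on `N` the coordinates `i` and `i₀` vanish, so `N` sits in the line spanned by the third basis vector `bM k`
    have hx0 : snf.bM.repr x i = 0 := snf.repr_eq_zero_of_notMem_range ⟨x, hxN⟩ hi'
    have hx1 : snf.bM.repr x i₀ = 0 := snf.repr_eq_zero_of_notMem_range ⟨x, hxN⟩ hi₀
    have hy0 : snf.bM.repr y i = 0 := snf.repr_eq_zero_of_notMem_range ⟨y, hyN⟩ hi'
    have hy1 : snf.bM.repr y i₀ = 0 := snf.repr_eq_zero_of_notMem_range ⟨y, hyN⟩ hi₀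
    obtain ⟨k, hk, hk₀⟩ : ∃ k : Fin 3, k ≠ i ∧ k ≠ i₀ := fin3_third i i₀ hi
    have hcoord : ∀ z : L, snf.bM.repr z i = 0 → snf.bM.repr z i₀ = 0 → z = snf.bM.repr z k • snf.bM k := by
      intro z hz hz₀
      have hrepr : z = ∑ j, snf.bM.repr z j • snf.bM j := (snf.bM.sum_repr z).symm
      conv_lhs => rw [hrepr]
      rw [Fin.sum_univ_three]
      have hcases : ∀ j : Fin 3, j = i ∨ j = i₀ ∨ j = k := fin3_cases i i₀ k hi hk hk₀
      -- kill the two vanishing coordinates, keep `k`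
      have hjz : ∀ j : Fin 3, j ≠ k → snf.bM.repr z j • snf.bM j = 0 := by
        intro j hjk
        rcases hcases j with rfl | rfl | rfl
        · rw [hz, zero_smul]
        · rw [hz₀, zero_smul]
        · exact absurd rfl hjk
      fin_cases k
      · rw [hjz 1 (by decide), hjz 2 (by decide)]; simp
      · rw [hjz 0 (by decide), hjz 2 (by decide)]; simp
      · rw [hjz 0 (by decide), hjz 1 (by decide)]; simp
    obtain ⟨cx, hx'⟩ : ∃ c : ℤ, x = c • snf.bM k := ⟨_, hcoord x hx0 hx1⟩
    obtain ⟨cy, hy'⟩ : ∃ c : ℤ, y = c • snf.bM k := ⟨_, hcoord y hy0 hy1⟩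
    -- dependence: `cy • x - cx • y = 0`
    have hrel : cy • x + (-cx) • y = 0 := by
      rw [hx', hy', smul_smul, smul_smul, ← add_smul]
      have : cy * cx + -cx * cy = 0 := by ring
      rw [this, zero_smul]
    obtain ⟨-, ht⟩ := hind _ _ hrel
    have hxk : cx = 0 := by simpa using ht
    have hx0' : x = 0 := by rw [hx', hxk, zero_smul]
    have := hind 1 0 (by rw [hx0', smul_zero, zero_smul, add_zero])
    exact one_ne_zero this.1
  refine ⟨snf.bM, i₀, ?_, ?_, ?_⟩
  · -- `φ (bM i₀) ≠ 0`: else `φ = 0`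
    intro hφ0
    obtain ⟨x, hx⟩ := h0
    apply hx
    have hrepr : x = ∑ i, snf.bM.repr x i • snf.bM i := (snf.bM.sum_repr x).symm
    rw [hrepr, map_sum]
    refine Finset.sum_eq_zero fun i _ => ?_
    rw [map_zsmul]
    by_cases hi : i = i₀
    · rw [hi, hφ0, smul_zero]
    · obtain ⟨j, hj⟩ := hother i hi
      rw [← hj, hfi j, smul_zero]
  · intro i hi
    obtain ⟨j, hj⟩ := hother i hi
    rw [← hj]; exact hfi j
  · intro f
    have hrepr : f = ∑ i, snf.bM.repr f i • snf.bM i := (snf.bM.sum_repr f).symm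
    conv_lhs => rw [hrepr]
    rw [map_sum, Finset.sum_eq_single i₀]
    · rw [map_zsmul]
    · intro i _ hi
      obtain ⟨j, hj⟩ := hother i hi
      rw [map_zsmul, ← hj, hfi j, smul_zero]
    · intro h; exact absurd (Finset.mem_univ _) h

/-- With ordered values: after a sign the weight-carrying vector has positive weight, and every `f` of positive weight a positive coordinate. -/
theorem exists_kernel_adapted_basis_of_rank_two_ker_pos {L : Type} [AddCommGroup L] (b : Module.Basis (Fin 3) ℤ L) {W : Type}
    [AddCommGroup W] [LinearOrder W] [IsOrderedAddMonoid W] (φ : L →+ W) (h0 : ∃ x : L, φ x ≠ 0)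
    (h2 : ∃ x y : L, φ x = 0 ∧ φ y = 0 ∧ ∀ s t : ℤ, s • x + t • y = 0 → s = 0 ∧ t = 0) :
    ∃ (e : Module.Basis (Fin 3) ℤ L) (i₀ : Fin 3), 0 < φ (e i₀) ∧ (∀ i, i ≠ i₀ → φ (e i) = 0) ∧
      (∀ f : L, φ f = e.repr f i₀ • φ (e i₀)) ∧ ∀ f : L, 0 < φ f → 0 < e.repr f i₀ := by
  obtain ⟨e, i₀, hne, hker, hcoord⟩ := exists_kernel_adapted_basis_of_rank_two_ker b φ h0 h2
  -- sign
  obtain ⟨ε, hε, hpos⟩ : ∃ ε : ℤˣ, (ε = 1 ∨ ε = -1) ∧ 0 < (ε : ℤ) • φ (e i₀) := by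
    rcases lt_or_gt_of_ne hne with hlt | hgt
    · exact ⟨-1, Or.inr rfl, by simpa using hlt⟩
    · exact ⟨1, Or.inl rfl, by simpa using hgt⟩
  let w : Fin 3 → ℤˣ := fun i => if i = i₀ then ε else 1
  have hw : w i₀ = ε := by simp [w]
  have hεinv : ε⁻¹ = ε := by rcases hε with rfl | rfl <;> rfl
  refine ⟨e.unitsSMul w, i₀, ?_, ?_, ?_, ?_⟩
  · rw [Module.Basis.unitsSMul_apply, hw, Units.smul_def, map_zsmul]; exact hpos
  · intro i hi
    rw [Module.Basis.unitsSMul_apply, Units.smul_def, map_zsmul, hker i hi, smul_zero]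
  · intro f
    rw [Module.Basis.repr_unitsSMul, Module.Basis.unitsSMul_apply, hw, hεinv, Units.smul_def, Units.smul_def, map_zsmul,
      smul_smul, smul_eq_mul]
    have hεε : (ε : ℤ) * ε = 1 := by rcases hε with rfl | rfl <;> rfl
    rw [mul_comm ((ε : ℤ)) (e.repr f i₀), mul_assoc, hεε, mul_one]
    exact hcoord f
  · intro f hf
    have key : φ f = ((e.unitsSMul w).repr f i₀) • ((ε : ℤ) • φ (e i₀)) := by
      rw [Module.Basis.repr_unitsSMul, hw, hεinv, Units.smul_def, smul_smul, smul_eq_mul]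
      have hεε : (ε : ℤ) * ε = 1 := by rcases hε with rfl | rfl <;> rfl
      rw [mul_comm ((ε : ℤ)) (e.repr f i₀), mul_assoc, hεε, mul_one]
      exact hcoord f
    rw [key] at hf
    by_contra hle
    push Not at hle
    have : ((e.unitsSMul w).repr f i₀) • ((ε : ℤ) • φ (e i₀)) ≤ 0 :=
      smul_nonpos_of_nonpos_of_nonneg hle hpos.le
    exact absurd hf (not_lt.mpr this)

/-! ## (rev 6) CLASS (B) TORIC LEMMA — complete lattice form (the dichotomy `ρ = 2` / `ρ = 1` packaged)

Input the port has: a rank-3 exponent lattice `L` (basis `b` = exponents of `s₁,s₂,s₃` or any basis), the monomial valuation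
`φ : L →+ W` into the (archimedean, class (B)) value group, ONE non-trivial integer relation among the weights (from `rr Γ ≤ 2`, i.e. the
transcendence-defect hypothesis (htd) of the stub), and the finite set `F` of exponents of positive value that must become regular monomials.
Output: either (`ρ = 2`) an adapted triple `(m₁, m₂, e 2)` — `e` a basis with `φ(e 2) = 0`, `e 0, e 1 ∈ ℤm₁ + ℤm₂` unimodularly,
`φ(m₁), φ(m₂) > 0`, every `f ∈ F` with explicit coordinates, the `m₁, m₂`-ones positive —, or (`ρ = 1`) a basis `e` and an index `i₀` with
`φ(e i₀) > 0`, `φ(e i) = 0 (i ≠ i₀)`, `φ f = (e.repr f i₀) • φ(e i₀)` and every `f` of positive value having positive `i₀`-coordinate. -/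

theorem toric_lemma_classB {L : Type} [AddCommGroup L] (b : Module.Basis (Fin 3) ℤ L) {W : Type} [AddCommGroup W] [LinearOrder W]
    [IsOrderedAddMonoid W] [Archimedean W] (φ : L →+ W) (hrel : ∃ x : L, x ≠ 0 ∧ φ x = 0) (hne : ∃ x : L, φ x ≠ 0)
    (F : Finset L) (hF : ∀ f ∈ F, 0 < φ f) :
    (∃ (e : Module.Basis (Fin 3) ℤ L) (m₁ m₂ : L) (a b' c d : ℤ), φ (e 2) = 0 ∧ (a * d - b' * c = 1 ∨ a * d - b' * c = -1) ∧
      e 0 = a • m₁ + b' • m₂ ∧ e 1 = c • m₁ + d • m₂ ∧ 0 < φ m₁ ∧ 0 < φ m₂ ∧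
      (∀ f : L, φ f = 0 → e.repr f 0 = 0 ∧ e.repr f 1 = 0) ∧
      ∀ f ∈ F, f = (e.repr f 0 * a + e.repr f 1 * c) • m₁ + (e.repr f 0 * b' + e.repr f 1 * d) • m₂ + e.repr f 2 • e 2 ∧
        0 < e.repr f 0 * a + e.repr f 1 * c ∧ 0 < e.repr f 0 * b' + e.repr f 1 * d) ∨
    (∃ (e : Module.Basis (Fin 3) ℤ L) (i₀ : Fin 3), 0 < φ (e i₀) ∧ (∀ i, i ≠ i₀ → φ (e i) = 0) ∧
      (∀ f : L, φ f = e.repr f i₀ • φ (e i₀)) ∧ ∀ f : L, 0 < φ f → 0 < e.repr f i₀) := by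
  by_cases h2 : ∀ x y : L, φ x = 0 → φ y = 0 → ∃ s t : ℤ, (s ≠ 0 ∨ t ≠ 0) ∧ s • x + t • y = 0
  · left
    obtain ⟨e, hker, hind⟩ := exists_kernel_adapted_basis b φ hrel h2
    obtain ⟨m₁, m₂, a, b', c, d, hdet, h0, h1, hm₁, hm₂, hcoord⟩ :=
      exists_adapted_basis_rank3_archimedean e φ hker hind F hF
    -- (rev 9) the kernel clause: `ker φ = ℤ · e 2`
    have hkc : ∀ f : L, φ f = 0 → e.repr f 0 = 0 ∧ e.repr f 1 = 0 := by
      intro f hf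
      apply hind
      have hrepr : f = e.repr f 0 • e 0 + e.repr f 1 • e 1 + e.repr f 2 • e 2 := by
        conv_lhs => rw [← e.sum_repr f]
        rw [Fin.sum_univ_three]
      have h := hf
      rw [hrepr, map_add, map_add, map_zsmul, map_zsmul, map_zsmul, hker, smul_zero, add_zero] at h
      exact h
    exact ⟨e, m₁, m₂, a, b', c, d, hker, hdet, h0, h1, hm₁, hm₂, hkc, hcoord⟩
  · right
    push Not at h2
    obtain ⟨x, y, hx, hy, hind⟩ := h2
    refine exists_kernel_adapted_basis_of_rank_two_ker_pos b φ hne ⟨x, y, hx, hy, fun s t hst => ?_⟩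
    by_contra hnot
    rw [not_and_or] at hnot
    rcases hnot with hs | ht
    · exact hind s t (Or.inl hs) hst
    · exact hind s t (Or.inr ht) hst

/-! ## (rev 7) Class (C): the two-level (lexicographic) toric lemma, lattice form

Class (C) = the value group `Γ` has rank two (a proper convex subgroup `Δ`); `rr Γ = 2` by (htd).  On the exponent lattice `L ≅ ℤ³`
the weight is then read through TWO integer functionals supplied by the port: `φ₁` = the class of the value in `Γ/Δ` and `φ₂` = a
`Δ`-coordinate (both identified with `ℤ` on the finitely generated image, a section chosen once); `v`-positivity of a monomial is
LEX-positivity `0 < φ₁ ∨ (φ₁ = 0 ∧ 0 < φ₂)`.  Internally this is the weight `Φ = (φ₁, φ₂) : L →+ ℤ ×ₗ ℤ`, a linearly ordered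
(non-archimedean) group, so `exists_kernel_adapted_basis` and the `ρ = 1` branch apply verbatim; for `ρ = 2` the plane is refined by
`exists_unimodular_lex_refinement`.  Output: either (`ρ = 2`) an adapted basis `(m₁, m₂, e 2)` with `e 2` of weight zero, `m₁` of
positive `φ₁`-weight, `m₂` of weight `(0, b₂)`, `b₂ > 0`, and every `f ∈ F` with non-negative `(m₁, m₂)`-coordinates that are
lex-positive (so some coordinate on a value-positive vector is positive — what §13(b) of the memo uses); or (`ρ = 1`) one basis vector
of positive weight carrying all the weight. -/

/-- **TORIC LEMMA, class (C) (two-level weights), lattice form, complete.** -/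
theorem toric_lemma_classC {L : Type} [AddCommGroup L] (b : Module.Basis (Fin 3) ℤ L) (φ₁ φ₂ : L →+ ℤ)
    (hrel : ∃ x : L, x ≠ 0 ∧ φ₁ x = 0 ∧ φ₂ x = 0) (hne : ∃ x : L, φ₁ x ≠ 0 ∨ φ₂ x ≠ 0)
    (F : Finset L) (hF : ∀ f ∈ F, 0 < φ₁ f ∨ (φ₁ f = 0 ∧ 0 < φ₂ f)) :
    (∃ (e : Module.Basis (Fin 3) ℤ L) (m₁ m₂ : L) (a b' c d : ℤ),
      (φ₁ (e 2) = 0 ∧ φ₂ (e 2) = 0) ∧ (a * d - b' * c = 1 ∨ a * d - b' * c = -1) ∧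
      e 0 = a • m₁ + b' • m₂ ∧ e 1 = c • m₁ + d • m₂ ∧
      0 < φ₁ m₁ ∧ (φ₁ m₂ = 0 ∧ 0 < φ₂ m₂) ∧
      (∀ f : L, φ₁ f = 0 → φ₂ f = 0 → e.repr f 0 = 0 ∧ e.repr f 1 = 0) ∧
      ∀ f ∈ F, f = (e.repr f 0 * a + e.repr f 1 * c) • m₁ + (e.repr f 0 * b' + e.repr f 1 * d) • m₂ + e.repr f 2 • e 2 ∧
        0 ≤ e.repr f 0 * a + e.repr f 1 * c ∧ 0 ≤ e.repr f 0 * b' + e.repr f 1 * d ∧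
        (0 < e.repr f 0 * a + e.repr f 1 * c ∨
          (e.repr f 0 * a + e.repr f 1 * c = 0 ∧ 0 < e.repr f 0 * b' + e.repr f 1 * d))) ∨
    (∃ (e : Module.Basis (Fin 3) ℤ L) (i₀ : Fin 3),
      (0 < φ₁ (e i₀) ∨ (φ₁ (e i₀) = 0 ∧ 0 < φ₂ (e i₀))) ∧ (∀ i, i ≠ i₀ → φ₁ (e i) = 0 ∧ φ₂ (e i) = 0) ∧
      (∀ f : L, φ₁ f = e.repr f i₀ * φ₁ (e i₀) ∧ φ₂ f = e.repr f i₀ * φ₂ (e i₀)) ∧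
      ∀ f : L, (0 < φ₁ f ∨ (φ₁ f = 0 ∧ 0 < φ₂ f)) → 0 < e.repr f i₀) := by
  classical
  -- the lexicographic weight `Φ = (φ₁, φ₂) : L → ℤ ×ₗ ℤ`
  let Φ : L →+ ℤ ×ₗ ℤ :=
    { toFun := fun x => toLex (φ₁ x, φ₂ x)
      map_zero' := by simp only [map_zero]; rfl
      map_add' := fun x y => by simp only [map_add]; rfl }
  have hΦ : ∀ x, Φ x = toLex (φ₁ x, φ₂ x) := fun _ => rfl
  have h0lex : (0 : ℤ ×ₗ ℤ) = toLex ((0 : ℤ), (0 : ℤ)) := rfl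
  have hΦzero : ∀ x, Φ x = 0 ↔ φ₁ x = 0 ∧ φ₂ x = 0 := fun x => by
    rw [hΦ, h0lex, toLex_inj, Prod.mk.injEq]
  have hΦpos : ∀ x, 0 < Φ x ↔ 0 < φ₁ x ∨ (φ₁ x = 0 ∧ 0 < φ₂ x) := fun x => by
    rw [hΦ, h0lex, Prod.Lex.toLex_lt_toLex]
    exact or_congr Iff.rfl (and_congr eq_comm Iff.rfl)
  by_cases h2 : ∀ x y : L, Φ x = 0 → Φ y = 0 → ∃ s t : ℤ, (s ≠ 0 ∨ t ≠ 0) ∧ s • x + t • y = 0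
  · left
    obtain ⟨x₀, hx₀, hx₀1, hx₀2⟩ := hrel
    obtain ⟨e, hker, hind⟩ := exists_kernel_adapted_basis b Φ ⟨x₀, hx₀, (hΦzero x₀).mpr ⟨hx₀1, hx₀2⟩⟩ h2
    have hker' : φ₁ (e 2) = 0 ∧ φ₂ (e 2) = 0 := (hΦzero _).mp hker
    -- coordinates
    have hrepr : ∀ f : L, f = e.repr f 0 • e 0 + e.repr f 1 • e 1 + e.repr f 2 • e 2 := by
      intro f
      conv_lhs => rw [← e.sum_repr f]
      rw [Fin.sum_univ_three]
    have hφ₁ : ∀ f : L, φ₁ f = e.repr f 0 * φ₁ (e 0) + e.repr f 1 * φ₁ (e 1) := by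
      intro f
      conv_lhs => rw [hrepr f]
      rw [map_add, map_add, map_zsmul, map_zsmul, map_zsmul, hker'.1, smul_zero, add_zero, smul_eq_mul, smul_eq_mul]
    have hφ₂ : ∀ f : L, φ₂ f = e.repr f 0 * φ₂ (e 0) + e.repr f 1 * φ₂ (e 1) := by
      intro f
      conv_lhs => rw [hrepr f]
      rw [map_add, map_add, map_zsmul, map_zsmul, map_zsmul, hker'.2, smul_zero, add_zero, smul_eq_mul, smul_eq_mul]
    -- the two weight vectors are independent: non-zero determinant
    have hlin : ∀ u v : ℤ, u • Φ (e 0) + v • Φ (e 1) =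
        toLex (u * φ₁ (e 0) + v * φ₁ (e 1), u * φ₂ (e 0) + v * φ₂ (e 1)) := by
      intro u v
      rw [← map_zsmul Φ, ← map_zsmul Φ, ← map_add Φ, hΦ]
      simp only [map_add, map_zsmul, smul_eq_mul]
    have hdet : φ₁ (e 0) * φ₂ (e 1) - φ₁ (e 1) * φ₂ (e 0) ≠ 0 := by
      intro hdet
      have hq : φ₂ (e 1) = 0 ∧ -φ₂ (e 0) = 0 := by
        apply hind
        rw [hlin, h0lex, toLex_inj, Prod.mk.injEq]
        constructor
        · linear_combination hdet
        · ring
      have hp : φ₁ (e 1) = 0 ∧ -φ₁ (e 0) = 0 := by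
        apply hind
        rw [hlin, h0lex, toLex_inj, Prod.mk.injEq]
        constructor
        · ring
        · linear_combination (-1 : ℤ) * hdet
      have h10 : (1 : ℤ) = 0 ∧ (0 : ℤ) = 0 := by
        apply hind
        rw [hlin, h0lex, toLex_inj, Prod.mk.injEq, neg_eq_zero.mp hp.2, neg_eq_zero.mp hq.2]
        constructor <;> ring
      exact one_ne_zero h10.1
    -- the lexicographic plane refinement
    obtain ⟨a, b', c, d, g, b₁, b₂, hdet1, hg, hb₂, hp₁, hp₂, hq₁, hq₂, hnonneg⟩ :=
      exists_unimodular_lex_refinement (φ₁ (e 0)) (φ₁ (e 1)) (φ₂ (e 0)) (φ₂ (e 1)) hdet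
        (F.image fun f => (e.repr f 0, e.repr f 1))
        (by
          intro g hg
          obtain ⟨f, hf, rfl⟩ := Finset.mem_image.mp hg
          have h := hF f hf
          rw [hφ₁ f, hφ₂ f] at h
          exact h)
    -- the new basis vectors (inverse of the unimodular matrix, sign-corrected)
    obtain ⟨ε, hε, hεdet⟩ : ∃ ε : ℤ, (ε = 1 ∨ ε = -1) ∧ ε * (a * d - b' * c) = 1 := by
      rcases hdet1 with h | h
      · exact ⟨1, Or.inl rfl, by rw [h]; ring⟩
      · exact ⟨-1, Or.inr rfl, by rw [h]; ring⟩
    -- (rev 9) the kernel clause: `ker Φ = ℤ · e 2`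
    have hkc : ∀ f : L, φ₁ f = 0 → φ₂ f = 0 → e.repr f 0 = 0 ∧ e.repr f 1 = 0 := by
      intro f hf1 hf2
      apply hind
      rw [hlin, ← hφ₁ f, ← hφ₂ f, hf1, hf2]
      rfl
    refine ⟨e, ε • (d • e 0 - b' • e 1), ε • (-c • e 0 + a • e 1), a, b', c, d, hker', hdet1, ?_, ?_, ?_, ?_, hkc, ?_⟩
    · have : a • (ε • (d • e 0 - b' • e 1)) + b' • (ε • (-c • e 0 + a • e 1)) = (ε * (a * d - b' * c)) • e 0 := by
        module
      rw [this, hεdet, one_smul]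
    · have : c • (ε • (d • e 0 - b' • e 1)) + d • (ε • (-c • e 0 + a • e 1)) = (ε * (a * d - b' * c)) • e 1 := by
        module
      rw [this, hεdet, one_smul]
    · have : φ₁ (ε • (d • e 0 - b' • e 1)) = (ε * (a * d - b' * c)) * g := by
        rw [map_zsmul, map_sub, map_zsmul, map_zsmul, hp₁, hp₂]
        simp only [smul_eq_mul]
        ring
      rw [this, hεdet, one_mul]
      exact hg
    · constructor
      · have : φ₁ (ε • (-c • e 0 + a • e 1)) = 0 := by
          rw [map_zsmul, map_add, map_zsmul, map_zsmul, hp₁, hp₂]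
          simp only [smul_eq_mul]
          ring
        exact this
      · have : φ₂ (ε • (-c • e 0 + a • e 1)) = (ε * (a * d - b' * c)) * b₂ := by
          rw [map_zsmul, map_add, map_zsmul, map_zsmul, hq₁, hq₂]
          simp only [smul_eq_mul]
          ring
        rw [this, hεdet, one_mul]
        exact hb₂
    · intro f hf
      have hg' := hnonneg (e.repr f 0, e.repr f 1) (Finset.mem_image.mpr ⟨f, hf, rfl⟩)
      have key : (e.repr f 0 * a + e.repr f 1 * c) • (ε • (d • e 0 - b' • e 1)) +
          (e.repr f 0 * b' + e.repr f 1 * d) • (ε • (-c • e 0 + a • e 1)) =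
          (ε * (a * d - b' * c) * e.repr f 0) • e 0 + (ε * (a * d - b' * c) * e.repr f 1) • e 1 := by
        module
      have hdecomp : f = (e.repr f 0 * a + e.repr f 1 * c) • (ε • (d • e 0 - b' • e 1)) +
          (e.repr f 0 * b' + e.repr f 1 * d) • (ε • (-c • e 0 + a • e 1)) + e.repr f 2 • e 2 := by
        rw [key, hεdet, one_mul, one_mul]
        exact hrepr f
      refine ⟨hdecomp, hg'.1, hg'.2, ?_⟩
      have hφ₁f : φ₁ f = (e.repr f 0 * a + e.repr f 1 * c) * g := by
        rw [hφ₁ f, hp₁, hp₂]; ring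
      have hφ₂f : φ₂ f = (e.repr f 0 * a + e.repr f 1 * c) * b₁ + (e.repr f 0 * b' + e.repr f 1 * d) * b₂ := by
        rw [hφ₂ f, hq₁, hq₂]; ring
      rcases hF f hf with h | ⟨h1, h2⟩
      · left
        rw [hφ₁f] at h
        by_contra hC
        have hC0 : e.repr f 0 * a + e.repr f 1 * c = 0 := le_antisymm (not_lt.mp hC) hg'.1
        rw [hC0, zero_mul] at h
        exact lt_irrefl _ h
      · right
        have hC₁ : e.repr f 0 * a + e.repr f 1 * c = 0 := by
          rw [hφ₁f] at h1
          rcases mul_eq_zero.mp h1 with h | h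
          · exact h
          · exact absurd h hg.ne'
        refine ⟨hC₁, ?_⟩
        rw [hφ₂f, hC₁, zero_mul, zero_add] at h2
        by_contra hC
        have hC0 : e.repr f 0 * b' + e.repr f 1 * d = 0 := le_antisymm (not_lt.mp hC) hg'.2
        rw [hC0, zero_mul] at h2
        exact lt_irrefl _ h2
  · right
    push Not at h2
    obtain ⟨x, y, hx, hy, hind⟩ := h2
    have hind' : ∀ s t : ℤ, s • x + t • y = 0 → s = 0 ∧ t = 0 := by
      intro s t hst
      by_contra hnot
      rw [not_and_or] at hnot
      rcases hnot with hs | ht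
      · exact hind s t (Or.inl hs) hst
      · exact hind s t (Or.inr ht) hst
    obtain ⟨x₁, hx₁⟩ := hne
    have h0 : ∃ x : L, Φ x ≠ 0 := by
      refine ⟨x₁, fun h => ?_⟩
      rcases hx₁ with h' | h'
      · exact h' ((hΦzero x₁).mp h).1
      · exact h' ((hΦzero x₁).mp h).2
    obtain ⟨e, i₀, hpos, hker, hrepr, hposf⟩ :=
      exists_kernel_adapted_basis_of_rank_two_ker_pos b Φ h0 ⟨x, y, hx, hy, hind'⟩
    refine ⟨e, i₀, (hΦpos _).mp hpos, fun i hi => (hΦzero _).mp (hker i hi), fun f => ?_,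
      fun f hf => hposf f ((hΦpos f).mpr hf)⟩
    have h := hrepr f
    rw [← map_zsmul Φ, hΦ, hΦ, toLex_inj, Prod.mk.injEq, map_zsmul, map_zsmul, smul_eq_mul, smul_eq_mul] at h
    exact h

/-! ## (rev 8) The TWO-LEVEL READING of a rank-two weight — the input `φ₁, φ₂` of `toric_lemma_classC`

The port has, in class (C): the monomial weight `φ : L →+ W` (`W` = the value group of `v`, written additively), the coarsening
`ψ : W →+ W₁` to the value group of the rank-one coarsening `v₁` (Mathlib `ValuationSubring.mapOfLE`, monotone), and from (htd)
`rr Γ ≤ 2`: both `W₁ = Γ/Δ` and `Δ = ker ψ` have rational rank `≤ 1` (any two elements are `ℤ`-dependent); finally some parameter has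
value outside `Δ` (else `v(M^×) ⊆ Δ`, impossible for a rank-two group of finite index).  From exactly these data the theorem produces
`φ₁, φ₂ : L →+ ℤ` with `0 < φ f ⟺ 0 < φ₁ f ∨ (φ₁ f = 0 ∧ 0 < φ₂ f)` and `φ f = 0 ⟺ φ₁ f = φ₂ f = 0` for ALL `f ∈ L` — so the hypotheses
and the conclusions of `toric_lemma_classC` translate to and from `v`-values of monomials.  Proof: the coarse weight `ψ ∘ φ` has a kernel
of rank two, so (`exists_kernel_adapted_basis_of_rank_two_ker_pos`) one basis vector `e_{i₁}` carries it: `φ₁ :=` its coordinate; the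
remainder `φ' := φ − φ₁ • φ(e_{i₁})` takes values in `Δ`, and either vanishes (`φ₂ := 0`) or again has a rank-two kernel, whence `φ₂`. -/

lemma fin3_other (i₀ : Fin 3) : ∃ j : Fin 3, j ≠ i₀ := by
  revert i₀; decide

/-- **THE TWO-LEVEL READING** (class (C)): integer functionals `φ₁, φ₂` reading `v`-positivity of monomials lexicographically. -/
theorem exists_two_level_reading {L : Type} [AddCommGroup L] (b : Module.Basis (Fin 3) ℤ L)
    {W W₁ : Type} [AddCommGroup W] [LinearOrder W] [IsOrderedAddMonoid W]
    [AddCommGroup W₁] [LinearOrder W₁] [IsOrderedAddMonoid W₁]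
    (φ : L →+ W) (ψ : W →+ W₁) (hψ : Monotone ψ)
    (hW₁ : ∀ w w' : W₁, ∃ s t : ℤ, (s ≠ 0 ∨ t ≠ 0) ∧ s • w + t • w' = 0)
    (hΔ : ∀ w w' : W, ψ w = 0 → ψ w' = 0 → ∃ s t : ℤ, (s ≠ 0 ∨ t ≠ 0) ∧ s • w + t • w' = 0)
    (hne : ∃ x : L, ψ (φ x) ≠ 0) :
    ∃ φ₁ φ₂ : L →+ ℤ, ∀ f : L,
      (0 < φ f ↔ 0 < φ₁ f ∨ (φ₁ f = 0 ∧ 0 < φ₂ f)) ∧ (φ f = 0 ↔ φ₁ f = 0 ∧ φ₂ f = 0) := by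
  classical
  -- the coarse weight
  let χ : L →+ W₁ := ψ.comp φ
  have hχ : ∀ x, χ x = ψ (φ x) := fun _ => rfl
  -- Step 1: a basis vector of non-zero coarse weight, and two independent vectors of coarse weight zero
  obtain ⟨i₀, hi₀⟩ : ∃ i₀ : Fin 3, χ (b i₀) ≠ 0 := by
    by_contra hall
    push Not at hall
    obtain ⟨x, hx⟩ := hne
    apply hx
    rw [← hχ, ← b.sum_repr x, map_sum]
    exact Finset.sum_eq_zero fun i _ => by rw [map_zsmul, hall i, smul_zero]
  obtain ⟨j, hj⟩ := fin3_other i₀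
  obtain ⟨k, hkj, hk⟩ := fin3_third j i₀ hj
  have hkv : ∀ i : Fin 3, ∃ s t : ℤ, s ≠ 0 ∧ χ (s • b i + t • b i₀) = 0 := by
    intro i
    obtain ⟨s, t, hst, h⟩ := hW₁ (χ (b i)) (χ (b i₀))
    by_cases hs : s = 0
    · subst hs
      rw [zero_smul, zero_add] at h
      rcases hst with h0 | h0
      · exact absurd rfl h0
      · exact absurd ((smul_eq_zero.mp h).resolve_left h0) hi₀
    · exact ⟨s, t, hs, by rw [map_add, map_zsmul, map_zsmul]; exact h⟩
  obtain ⟨s₁, t₁, hs₁, hx⟩ := hkv j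
  obtain ⟨s₂, t₂, hs₂, hy⟩ := hkv k
  have hind : ∀ s t : ℤ, s • (s₁ • b j + t₁ • b i₀) + t • (s₂ • b k + t₂ • b i₀) = 0 → s = 0 ∧ t = 0 := by
    intro s t hst
    have hcj := congrArg (fun z => b.repr z j) hst
    have hck := congrArg (fun z => b.repr z k) hst
    simp only [map_add, map_zsmul, map_zero, Finsupp.coe_add, Finsupp.coe_smul, Pi.add_apply, Pi.smul_apply,
      Module.Basis.repr_self, Finsupp.single_apply, Finsupp.coe_zero, Pi.zero_apply, smul_eq_mul,
      Ne.symm hj, hkj, Ne.symm hk, Ne.symm hkj, if_true, if_false] at hcj hck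
    constructor
    · have h1 : s * s₁ = 0 := by rw [← hcj]; ring
      exact (mul_eq_zero.mp h1).resolve_right hs₁
    · have h1 : t * s₂ = 0 := by rw [← hck]; ring
      exact (mul_eq_zero.mp h1).resolve_right hs₂
  -- Step 2: the coarse weight is carried by one basis vector `e i₁`; `φ₁ :=` its coordinate
  obtain ⟨e, i₁, hpos₁, -, hrepr₁, -⟩ :=
    exists_kernel_adapted_basis_of_rank_two_ker_pos b χ ⟨b i₀, hi₀⟩
      ⟨s₁ • b j + t₁ • b i₀, s₂ • b k + t₂ • b i₀, hx, hy, hind⟩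
  let φ₁ : L →+ ℤ :=
    { toFun := fun f => e.repr f i₁
      map_zero' := by simp
      map_add' := fun f g => by simp }
  have hφ₁ : ∀ f, φ₁ f = e.repr f i₁ := fun _ => rfl
  have hw₁ψ : 0 < ψ (φ (e i₁)) := by simpa only [hχ] using hpos₁
  have hw₁ : 0 < φ (e i₁) := by
    by_contra hle
    push Not at hle
    have h := hψ hle
    rw [map_zero] at h
    exact absurd hw₁ψ (not_lt.mpr h)
  -- Step 3: the fine part `φ' := φ - φ₁ • φ (e i₁)` takes values in `ker ψ`
  let φ' : L →+ W :=
    { toFun := fun f => φ f - e.repr f i₁ • φ (e i₁)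
      map_zero' := by simp
      map_add' := fun f g => by
        simp only [map_add, Finsupp.coe_add, Pi.add_apply, add_smul]
        abel }
  have hφ' : ∀ f, φ' f = φ f - e.repr f i₁ • φ (e i₁) := fun _ => rfl
  have hφ'ψ : ∀ f, ψ (φ' f) = 0 := by
    intro f
    rw [hφ', map_sub, map_zsmul]
    have h := hrepr₁ f
    simp only [hχ] at h
    rw [h, sub_self]
  have hdecomp : ∀ f, φ f = e.repr f i₁ • φ (e i₁) + φ' f := fun f => by rw [hφ']; abel
  have hφ'e : φ' (e i₁) = 0 := by
    rw [hφ', Module.Basis.repr_self, Finsupp.single_eq_same, one_smul, sub_self]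
  by_cases hzero : ∀ i, φ' (e i) = 0
  · -- one level only: `φ = φ₁ • w₁`
    have hφ'0 : ∀ f, φ' f = 0 := by
      intro f
      rw [← e.sum_repr f, map_sum]
      exact Finset.sum_eq_zero fun i _ => by rw [map_zsmul, hzero i, smul_zero]
    refine ⟨φ₁, 0, fun f => ⟨?_, ?_⟩⟩
    · rw [hdecomp f, hφ'0 f, add_zero, AddMonoidHom.zero_apply, hφ₁]
      constructor
      · intro h
        left
        by_contra hle
        push Not at hle
        exact absurd h (not_lt.mpr (smul_nonpos_of_nonpos_of_nonneg hle hw₁.le))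
      · rintro (h | ⟨_, h⟩)
        · exact smul_pos h hw₁
        · exact absurd h (lt_irrefl _)
    · rw [hdecomp f, hφ'0 f, add_zero, AddMonoidHom.zero_apply, hφ₁]
      constructor
      · intro h
        exact ⟨(smul_eq_zero.mp h).resolve_right hw₁.ne', rfl⟩
      · rintro ⟨h, -⟩
        rw [h, zero_smul]
  · -- second level: `φ'` is carried by one vector of a further adapted basis
    push Not at hzero
    obtain ⟨i₂, hi₂⟩ := hzero
    obtain ⟨j', hj'⟩ := fin3_other i₁
    obtain ⟨k', hk'j', hk'⟩ := fin3_third j' i₁ hj'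
    obtain ⟨s, t, hst, hrel⟩ := hΔ (φ' (e j')) (φ' (e k')) (hφ'ψ (e j')) (hφ'ψ (e k'))
    have hyk : φ' (s • e j' + t • e k') = 0 := by rw [map_add, map_zsmul, map_zsmul]; exact hrel
    have hind' : ∀ σ τ : ℤ, σ • e i₁ + τ • (s • e j' + t • e k') = 0 → σ = 0 ∧ τ = 0 := by
      intro σ τ h
      have hc1 := congrArg (fun z => e.repr z i₁) h
      have hcj := congrArg (fun z => e.repr z j') h
      have hck := congrArg (fun z => e.repr z k') h
      simp only [map_add, map_zsmul, map_zero, Finsupp.coe_add, Finsupp.coe_smul, Pi.add_apply, Pi.smul_apply,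
        Module.Basis.repr_self, Finsupp.single_apply, Finsupp.coe_zero, Pi.zero_apply, smul_eq_mul,
        Ne.symm hj', hk', Ne.symm hk', hj', hk'j', Ne.symm hk'j', if_true, if_false] at hc1 hcj hck
      have hσ : σ = 0 := by rw [← hc1]; ring
      have hτs : τ * s = 0 := by rw [← hcj]; ring
      have hτt : τ * t = 0 := by rw [← hck]; ring
      refine ⟨hσ, ?_⟩
      rcases hst with hs | ht
      · exact (mul_eq_zero.mp hτs).resolve_right hs
      · exact (mul_eq_zero.mp hτt).resolve_right ht
    obtain ⟨e', i₃, hpos₂, -, hrepr₂, -⟩ :=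
      exists_kernel_adapted_basis_of_rank_two_ker_pos b φ' ⟨e i₂, hi₂⟩
        ⟨e i₁, s • e j' + t • e k', hφ'e, hyk, hind'⟩
    let φ₂ : L →+ ℤ :=
      { toFun := fun f => e'.repr f i₃
        map_zero' := by simp
        map_add' := fun f g => by simp }
    have hφ₂ : ∀ f, φ₂ f = e'.repr f i₃ := fun _ => rfl
    have hw₂ : 0 < φ' (e' i₃) := hpos₂
    have hw₂ψ : ψ (φ' (e' i₃)) = 0 := hφ'ψ _
    have hf : ∀ f, φ f = e.repr f i₁ • φ (e i₁) + e'.repr f i₃ • φ' (e' i₃) := fun f => by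
      rw [hdecomp f, hrepr₂ f]
    have hψf : ∀ f, ψ (φ f) = e.repr f i₁ • ψ (φ (e i₁)) := fun f => by
      rw [hf f, map_add, map_zsmul, map_zsmul, hw₂ψ, smul_zero, add_zero]
    refine ⟨φ₁, φ₂, fun f => ⟨?_, ?_⟩⟩
    · rw [hφ₁, hφ₂]
      constructor
      · intro hpos
        have h0 : 0 ≤ ψ (φ f) := by simpa using hψ hpos.le
        rw [hψf f] at h0
        have hn : 0 ≤ e.repr f i₁ := by
          by_contra hlt
          push Not at hlt
          exact absurd h0 (not_le.mpr (smul_neg_of_neg_of_pos hlt hw₁ψ))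
        rcases hn.lt_or_eq with hn | hn
        · exact Or.inl hn
        · right
          refine ⟨hn.symm, ?_⟩
          rw [hf f, ← hn, zero_smul, zero_add] at hpos
          by_contra hle
          push Not at hle
          exact absurd hpos (not_lt.mpr (smul_nonpos_of_nonpos_of_nonneg hle hw₂.le))
      · rintro (hn | ⟨hn, hm⟩)
        · by_contra hle
          push Not at hle
          have h1 : ψ (φ f) ≤ 0 := by simpa using hψ hle
          rw [hψf f] at h1
          exact absurd (smul_pos hn hw₁ψ) (not_lt.mpr h1)
        · rw [hf f, hn, zero_smul, zero_add]
          exact smul_pos hm hw₂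
    · rw [hφ₁, hφ₂]
      constructor
      · intro h0
        have h1 : ψ (φ f) = 0 := by rw [h0, map_zero]
        rw [hψf f] at h1
        have hn : e.repr f i₁ = 0 := (smul_eq_zero.mp h1).resolve_right hw₁ψ.ne'
        refine ⟨hn, ?_⟩
        rw [hf f, hn, zero_smul, zero_add] at h0
        exact (smul_eq_zero.mp h0).resolve_right hw₂.ne'
      · rintro ⟨hn, hm⟩
        rw [hf f, hn, hm, zero_smul, zero_smul, add_zero]


end UnimodularRefinement

/-! ## KIT (R1A): `Lens5_RankOneArchimedean.lean` rev 4 (1e4ecbbc974d), body verbatim WITH proofs, under the sub-namespace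
`RankOneArchimedean` — consumed by (3-L-d) and the glue of PORT 3-L (rev 7). -/

namespace RankOneArchimedean


open ValuationSubring

variable {K : Type} [Field K]

/-- **No proper coarsening ⟹ archimedean (element form).**  If the only valuation subrings of `K` containing `O` are `O` and `K`, then for
`x` of value `< 1` and `y ≠ 0` some power of `v(x)` is `≤ v(y)`. OURS · CANDIDATE · counted 0. [folklore] -/
theorem exists_valuation_pow_le (O : ValuationSubring K) (hmax : ∀ O₁ : ValuationSubring K, O ≤ O₁ → O₁ = O ∨ O₁ = ⊤)
    (x y : K) (hx : O.valuation x < 1) (hy : y ≠ 0) : ∃ n : ℕ, O.valuation x ^ n ≤ O.valuation y := by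
  classical
  by_cases hx0 : x = 0
  · exact ⟨1, by simp [hx0]⟩
  by_cases hy1 : 1 ≤ O.valuation y
  · exact ⟨0, by simpa using hy1⟩
  rw [not_le] at hy1
  have hxO : x ∈ O := (O.valuation_le_one_iff x).mp hx.le
  have hyO : y ∈ O := (O.valuation_le_one_iff y).mp hy1.le
  by_contra H
  rw [not_exists] at H
  -- the ideal `yO` misses all powers of `x`
  set a : O := ⟨x, hxO⟩ with ha
  set b : O := ⟨y, hyO⟩ with hb
  have hdisj : Disjoint ((Ideal.span {b} : Ideal O) : Set O) (Submonoid.powers a) := by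
    rw [Set.disjoint_left]
    rintro c hc ⟨n, rfl⟩
    obtain ⟨d, hd⟩ := Ideal.mem_span_singleton'.mp hc
    apply H n
    have hval : O.valuation ((d : K) * y) = O.valuation (x ^ n) := by
      have := congrArg (fun z : O => (z : K)) hd
      simpa [ha, hb] using congrArg O.valuation this
    calc O.valuation x ^ n = O.valuation (x ^ n) := (map_pow _ _ _).symm
      _ = O.valuation (d : K) * O.valuation y := by rw [← hval, map_mul]
      _ ≤ 1 * O.valuation y := by
          exact mul_le_mul_of_nonneg_right ((O.valuation_le_one_iff _).mpr d.2) zero_le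
      _ = O.valuation y := one_mul _
  obtain ⟨P, hP, hIP, hPS⟩ := Ideal.exists_le_prime_disjoint (Ideal.span {b}) (Submonoid.powers a) hdisj
  haveI := hP
  have haP : a ∉ P := fun h => Set.disjoint_left.mp hPS h ⟨1, pow_one a⟩
  have hbP : b ∈ P := hIP (Ideal.mem_span_singleton_self b)
  rcases hmax (ofPrime O P) (le_ofPrime O P) with h1 | h1
  · -- `O_P = O`: then `x` is a unit of `O`, contradicting `v(x) < 1`
    have hv1 : (ofPrime O P).valuation (a : K) = 1 := (ofPrime_valuation_eq_one_iff_mem_primeCompl O P a).mpr haP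
    have hv1' : (ofPrime O P).valuation x = 1 := hv1
    have hxinv : x⁻¹ ∈ ofPrime O P := by
      apply mem_of_valuation_le_one
      rw [map_inv₀, hv1', inv_one]
    rw [h1] at hxinv
    have h2 : O.valuation x⁻¹ ≤ 1 := (O.valuation_le_one_iff _).mpr hxinv
    rw [map_inv₀, inv_le_one₀ ((Valuation.pos_iff _).mpr hx0)] at h2
    exact absurd hx (not_lt.mpr h2)
  · -- `O_P = K`: then `y` is a unit of `O_P`, contradicting `y ∈ P`
    have hyinv : y⁻¹ ∈ ofPrime O P := by rw [h1]; exact mem_top _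
    have hv1 : (ofPrime O P).valuation y = 1 := by
      apply le_antisymm (((ofPrime O P).valuation_le_one_iff y).mpr (le_ofPrime O P hyO))
      have h2 : (ofPrime O P).valuation y⁻¹ ≤ 1 := ((ofPrime O P).valuation_le_one_iff _).mpr hyinv
      rwa [map_inv₀, inv_le_one₀ ((Valuation.pos_iff _).mpr hy)] at h2
    have hbP' : b ∈ P.primeCompl := (ofPrime_valuation_eq_one_iff_mem_primeCompl O P b).mp hv1
    exact hbP' hbP

/-- **No proper coarsening ⟹ the value group `Γ_O = (ValueGroup O)ˣ` is (multiplicatively) archimedean.** OURS · CANDIDATE · counted 0.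
[folklore] -/
theorem mulArchimedean_valueGroup_units (O : ValuationSubring K)
    (hmax : ∀ O₁ : ValuationSubring K, O ≤ O₁ → O₁ = O ∨ O₁ = ⊤) : MulArchimedean (ValueGroup O)ˣ := by
  refine ⟨fun u w hw => ?_⟩
  obtain ⟨x₀, hx₀⟩ := O.valuation_surjective (u : ValueGroup O)
  obtain ⟨y₀, hy₀⟩ := O.valuation_surjective (w : ValueGroup O)
  have hx₀0 : x₀ ≠ 0 := fun h => u.ne_zero (by rw [← hx₀, h, map_zero])
  have hy₀0 : y₀ ≠ 0 := fun h => w.ne_zero (by rw [← hy₀, h, map_zero])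
  have hupos : (0 : ValueGroup O) < u := zero_lt_iff.mpr u.ne_zero
  have hwpos : (0 : ValueGroup O) < w := zero_lt_iff.mpr w.ne_zero
  have hw' : (1 : ValueGroup O) < w := by exact_mod_cast hw
  have hlt : O.valuation y₀⁻¹ < 1 := by
    rw [map_inv₀, hy₀]
    exact inv_lt_one_of_one_lt₀ hw'
  obtain ⟨n, hn⟩ := exists_valuation_pow_le O hmax y₀⁻¹ x₀⁻¹ hlt (inv_ne_zero hx₀0)
  rw [map_inv₀, map_inv₀, hx₀, hy₀, inv_pow, inv_le_inv₀ (pow_pos hwpos n) hupos] at hn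
  refine ⟨n, ?_⟩
  exact_mod_cast hn

/-- The additive form the toric lemma consumes: `Archimedean (Additive (ValueGroup O)ˣ)` (Mathlib instance from `MulArchimedean`).
OURS · CANDIDATE · counted 0. [folklore] -/
theorem archimedean_additive_valueGroup_units (O : ValuationSubring K)
    (hmax : ∀ O₁ : ValuationSubring K, O ≤ O₁ → O₁ = O ∨ O₁ = ⊤) : Archimedean (Additive (ValueGroup O)ˣ) := by
  haveI := mulArchimedean_valueGroup_units O hmax
  infer_instance


/-! ## (rev 2) Class (C) input of `exists_two_level_reading`: rational rank `≤ 2` splits as `1 + 1` over a proper coarsening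

Pure `ℤ`-module bookkeeping (no valuations): `W` of `ℤ`-rank `≤ 2` (the port: `ratRank O ≤ 2`, from transcendence defect `≠ 0` and
Abhyankar's inequality in the tree), an additive map `ψ : W → W₁` (the port: the units map of `ValuationSubring.mapOfLE O O₁`, made
additive) with a non-zero kernel element (`O ≠ O₁`) and a non-zero value (`O₁ ≠ K`), torsion-freeness where needed (ordered groups are
torsion-free).  We prove the two dependence statements `Lens5_UnimodularRefinement.exists_two_level_reading` asks for:
(hΔ) `ker_pair_dependent_of_rank_le_two` — any two kernel elements are `ℤ`-dependent; (hW₁) `image_pair_dependent_of_rank_le_two` — any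
two values `ψ w, ψ w'` are `ℤ`-dependent, and `pair_dependent_of_rank_le_two_of_surjective` — the same for all of `W₁` when `ψ` is onto
(`mapOfLE` is).  Each is "three independent elements contradict rank `≤ 2`" (`LinearIndependent.cardinal_le_rank`). -/

/-- Three-term linear-independence test over `ℤ` in the `Fin 3` shape. -/
theorem linearIndependent_fin_three {W : Type} [AddCommGroup W] (v : Fin 3 → W)
    (h : ∀ a b c : ℤ, a • v 0 + b • v 1 + c • v 2 = 0 → a = 0 ∧ b = 0 ∧ c = 0) : LinearIndependent ℤ v := by
  rw [Fintype.linearIndependent_iff]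
  intro g hg i
  rw [Fin.sum_univ_three] at hg
  obtain ⟨h0, h1, h2⟩ := h (g 0) (g 1) (g 2) hg
  fin_cases i <;> assumption

/-- From `ℤ`-rank `≤ 2`: no three `ℤ`-linearly independent elements. -/
theorem not_linearIndependent_three_of_rank_le_two {W : Type} [AddCommGroup W] (hW : Module.rank ℤ W ≤ 2) (v : Fin 3 → W)
    (hv : LinearIndependent ℤ v) : False := by
  have h := hv.cardinal_le_rank
  rw [Cardinal.mk_fin] at h
  have h3 : ((3 : ℕ) : Cardinal.{0}) ≤ ((2 : ℕ) : Cardinal.{0}) := by exact_mod_cast h.trans hW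
  exact absurd (Nat.cast_le.mp h3) (by norm_num)

/-- **(hΔ) of `exists_two_level_reading`**: if `rank_ℤ W ≤ 2`, `W₁` is torsion-free and `ψ` takes a non-zero value, any two elements of
`ker ψ` are `ℤ`-dependent. OURS · CANDIDATE · counted 0. [folklore] -/
theorem ker_pair_dependent_of_rank_le_two {W W₁ : Type} [AddCommGroup W] [AddCommGroup W₁] [NoZeroSMulDivisors ℤ W₁]
    (hW : Module.rank ℤ W ≤ 2) (ψ : W →+ W₁) (hne : ∃ u : W, ψ u ≠ 0) :
    ∀ w w' : W, ψ w = 0 → ψ w' = 0 → ∃ s t : ℤ, (s ≠ 0 ∨ t ≠ 0) ∧ s • w + t • w' = 0 := by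
  intro w w' hw hw'
  obtain ⟨u, hu⟩ := hne
  by_contra H
  have H' : ∀ s t : ℤ, s • w + t • w' = 0 → s = 0 ∧ t = 0 := by
    intro s t hst
    by_contra h2
    exact H ⟨s, t, by tauto, hst⟩
  refine not_linearIndependent_three_of_rank_le_two hW ![w, w', u] (linearIndependent_fin_three _ fun a b c habc => ?_)
  simp only [Matrix.cons_val_zero, Matrix.cons_val_one, Matrix.cons_val] at habc
  have hc : c = 0 := by
    have := congrArg ψ habc
    rw [map_add, map_add, map_zsmul, map_zsmul, map_zsmul, hw, hw', smul_zero, smul_zero, zero_add, zero_add, map_zero,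
      smul_eq_zero] at this
    exact this.resolve_right hu
  rw [hc, zero_smul, add_zero] at habc
  obtain ⟨ha, hb⟩ := H' a b habc
  exact ⟨ha, hb, hc⟩

/-- **(hW₁) of `exists_two_level_reading`, image form**: if `rank_ℤ W ≤ 2`, `W` is torsion-free and `ker ψ ≠ 0`, any two VALUES `ψ w, ψ w'`
are `ℤ`-dependent. OURS · CANDIDATE · counted 0. [folklore] -/
theorem image_pair_dependent_of_rank_le_two {W W₁ : Type} [AddCommGroup W] [AddCommGroup W₁] [NoZeroSMulDivisors ℤ W]
    (hW : Module.rank ℤ W ≤ 2) (ψ : W →+ W₁) (hker : ∃ z : W, z ≠ 0 ∧ ψ z = 0) :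
    ∀ w w' : W, ∃ s t : ℤ, (s ≠ 0 ∨ t ≠ 0) ∧ s • ψ w + t • ψ w' = 0 := by
  intro w w'
  obtain ⟨z, hz0, hz⟩ := hker
  by_contra H
  have H' : ∀ s t : ℤ, s • ψ w + t • ψ w' = 0 → s = 0 ∧ t = 0 := by
    intro s t hst
    by_contra h2
    exact H ⟨s, t, by tauto, hst⟩
  refine not_linearIndependent_three_of_rank_le_two hW ![w, w', z] (linearIndependent_fin_three _ fun a b c habc => ?_)
  simp only [Matrix.cons_val_zero, Matrix.cons_val_one, Matrix.cons_val] at habc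
  have hab : a = 0 ∧ b = 0 := by
    have := congrArg ψ habc
    rw [map_add, map_add, map_zsmul, map_zsmul, map_zsmul, hz, smul_zero, add_zero, map_zero] at this
    exact H' a b this
  obtain ⟨ha, hb⟩ := hab
  rw [ha, hb, zero_smul, zero_smul, zero_add, zero_add, smul_eq_zero] at habc
  exact ⟨ha, hb, habc.resolve_right hz0⟩

/-- **(hW₁) for ALL of `W₁`** when `ψ` is surjective (the port: `mapOfLE` is surjective on value groups, every value of `O₁` being the
image of a value of `O`). OURS · CANDIDATE · counted 0. [folklore] -/
theorem pair_dependent_of_rank_le_two_of_surjective {W W₁ : Type} [AddCommGroup W] [AddCommGroup W₁] [NoZeroSMulDivisors ℤ W]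
    (hW : Module.rank ℤ W ≤ 2) (ψ : W →+ W₁) (hψ : Function.Surjective ψ) (hker : ∃ z : W, z ≠ 0 ∧ ψ z = 0) :
    ∀ w₁ w₁' : W₁, ∃ s t : ℤ, (s ≠ 0 ∨ t ≠ 0) ∧ s • w₁ + t • w₁' = 0 := by
  intro w₁ w₁'
  obtain ⟨w, rfl⟩ := hψ w₁
  obtain ⟨w', rfl⟩ := hψ w₁'
  exact image_pair_dependent_of_rank_le_two hW ψ hker w w'


/-! ## (rev 3) The relation hypothesis `hrel` of the toric lemmas from rank `≤ 2` -/

/-- **`hrel` of `toric_lemma_classB/C`**: three weights in a group of `ℤ`-rank `≤ 2` satisfy a non-trivial `ℤ`-relation — for ANY additive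
map `φ` out of a free rank-3 lattice `L` (basis `b`) into `W` with `rank_ℤ W ≤ 2` there is `x ≠ 0` with `φ x = 0`.  (Port: `L = Fin 3 → ℤ`,
`φ m = Σ mᵢ • γᵢ`, `γᵢ` the values of the parameters; `rank_ℤ W = ratRank O ≤ 2`.) OURS · CANDIDATE · counted 0. [folklore] -/
theorem exists_ne_zero_map_eq_zero_of_rank_le_two {L W : Type} [AddCommGroup L] [AddCommGroup W] (b : Module.Basis (Fin 3) ℤ L)
    (hW : Module.rank ℤ W ≤ 2) (φ : L →+ W) : ∃ x : L, x ≠ 0 ∧ φ x = 0 := by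
  by_contra H
  have hinj : ∀ x : L, φ x = 0 → x = 0 := fun x hx => by
    by_contra hx0
    exact H ⟨x, hx0, hx⟩
  refine not_linearIndependent_three_of_rank_le_two hW (fun i => φ (b i)) (linearIndependent_fin_three _ fun a c d h => ?_)
  have h' : φ (a • b 0 + c • b 1 + d • b 2) = 0 := by
    rw [map_add, map_add, map_zsmul, map_zsmul, map_zsmul]; exact h
  have h0 := hinj _ h'
  have hc := fun j => congrArg (fun z => b.repr z j) h0
  have e0 := hc 0; have e1 := hc 1; have e2 := hc 2
  simp only [map_add, map_zsmul, map_zero, Finsupp.coe_add, Finsupp.coe_smul, Pi.add_apply, Pi.smul_apply,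
    Module.Basis.repr_self, Finsupp.single_apply, Finsupp.coe_zero, Pi.zero_apply, smul_eq_mul] at e0 e1 e2
  simp only [Fin.isValue, ↓reduceIte, OfNat.ofNat_ne_one, Fin.zero_eq_one_iff, one_ne_zero,
    mul_one, mul_zero, add_zero, zero_add, Fin.reduceEq] at e0 e1 e2
  exact ⟨e0, e1, e2⟩


/-! ## (rev 4) `ratRank O ≤ 2` from the stub's transcendence-defect hypothesis (htd)

The rank hypothesis `Module.rank ℤ W ≤ 2` of the three lemmas above, for `W = Additive (ValueGroup O)ˣ` (so `Module.rank ℤ W = ratRank O`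
by `rfl`), from `transcendenceDefect k O hk ≠ 0` and `tr.deg_k K = 3` (the tree's `D + E + F = N`, `TranscendenceDefect.lean`); and the
stub-shaped wrapper deriving `tr.deg_k K = 3` from `dim A = 3`, `K = Frac A` (census pattern). -/

/-- `D ≠ 0`, `N = 3` ⟹ `E ≤ 2`. OURS · CANDIDATE · counted 0. [folklore] -/
theorem ratRank_le_two_of_transcendenceDefect_ne_zero {k : Type} [Field k] [Algebra k K] (O : ValuationSubring K)
    (hk : ∀ c : k, algebraMap k K c ∈ O) (htr : Algebra.trdeg k K = (3 : ℕ))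
    (hD : Literature.AlgebraicGeometry.Resolution.transcendenceDefect k O hk ≠ 0) :
    Module.rank ℤ (Additive (ValuationSubring.ValueGroup O)ˣ) ≤ 2 := by
  have hN : Algebra.trdeg k K < Cardinal.aleph0 := by rw [htr]; exact Cardinal.natCast_lt_aleph0
  have h := Literature.AlgebraicGeometry.Resolution.transcendenceDefect_add_toNat_eq O hk hN
  rw [htr, Cardinal.toNat_natCast] at h
  have hE : Cardinal.toNat (Literature.AlgebraicGeometry.Resolution.ratRank O) ≤ 2 := by omega
  have hfin := Literature.AlgebraicGeometry.Resolution.ratRank_lt_aleph0 O hk hN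
  change Literature.AlgebraicGeometry.Resolution.ratRank O ≤ 2
  rw [← Cardinal.cast_toNat_of_lt_aleph0 hfin]
  exact_mod_cast hE

/-- The same in the stub's shape: `K = Frac A`, `A` a finitely generated `k`-subalgebra of Krull dimension `3`, and (htd). OURS · CANDIDATE ·
counted 0. [folklore] -/
theorem ratRank_le_two_of_stub {k : Type} [Field k] [Algebra k K] (O : ValuationSubring K) (A : Subalgebra k K)
    (hAfg : A.FG) [IsFractionRing A K] (hdim : ringKrullDim A = 3)
    (htd : ∀ hk : ∀ c : k, algebraMap k K c ∈ O, Literature.AlgebraicGeometry.Resolution.transcendenceDefect k O hk ≠ 0)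
    (hk : ∀ c : k, algebraMap k K c ∈ O) :
    Module.rank ℤ (Additive (ValuationSubring.ValueGroup O)ˣ) ≤ 2 := by
  haveI : Algebra.FiniteType k A := A.fg_iff_finiteType.mp hAfg
  obtain ⟨d, hd, htrA⟩ := Literature.RingTheory.KrullDimension.exists_ringKrullDim_eq_and_trdeg_eq k A
  have hd3 : d = 3 := by
    rw [hd] at hdim
    exact_mod_cast hdim
  haveI : FaithfulSMul k A := (faithfulSMul_iff_algebraMap_injective k A).mpr (algebraMap k A).injective
  haveI : FaithfulSMul A K := (faithfulSMul_iff_algebraMap_injective A K).mpr (IsFractionRing.injective A K)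
  haveI : Algebra.IsAlgebraic A K := IsLocalization.isAlgebraic K (nonZeroDivisors A)
  have htrK : Algebra.trdeg k K = (3 : ℕ) := by
    rw [← trdeg_add_eq k A (A := K), trdeg_eq_zero (R := A) (A := K), add_zero, htrA, hd3]
  exact ratRank_le_two_of_transcendenceDefect_ne_zero O hk htrK (htd hk)


/-- **`hne` of `exists_two_level_reading` (port row §3 class (C))**: a valuation ring `O₁` of `K` containing a subfield `M` over which `K`
is algebraic is all of `K` — so a PROPER coarsening `O₁ ≠ ⊤` is non-trivial on `M⁺ = Frac T`, i.e. some parameter `zᵢ ∈ 𝔪_{O₁}`.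
(Valuation rings are integrally closed; `x` algebraic over the field `M ⊆ O₁` is integral over `O₁`.) OURS · CANDIDATE · counted 0. [folklore] -/
theorem eq_top_of_subfield_le_of_isAlgebraic (O₁ : ValuationSubring K) (M : Subfield K) (hM : M.toSubring ≤ O₁.toSubring)
    [Algebra.IsAlgebraic M K] : O₁ = ⊤ := by
  letI : Algebra M O₁ := (Subring.inclusion hM).toAlgebra
  haveI : IsScalarTower M O₁ K := IsScalarTower.of_algebraMap_eq (fun _ => rfl)
  haveI : Algebra.IsIntegral M K := inferInstance
  rw [_root_.eq_top_iff]
  intro x _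
  have hx : IsIntegral O₁ x := (Algebra.IsIntegral.isIntegral (R := M) x).tower_top
  obtain ⟨y, hy⟩ := (IsIntegrallyClosed.isIntegral_iff (R := O₁) (K := K)).mp hx
  rw [← hy]
  exact y.2


end RankOneArchimedean

/-! ## §H helpers (copies of the assembly's, with proofs) -/

/-- `dim A = 3` from the stub's `dim A ≤ 3` and `dim (locAtCentre A O) = 3` (a localisation does not raise the dimension;
copied from `Lens5_TwistModel.ringKrullDim_eq_three_of_locAtCentre`, with proof). [folklore] -/
theorem ringKrullDim_eq_three_of_locAtCentre {k K : Type} [Field k] [Field K] [Algebra k K] (O : ValuationSubring K)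
    (A : Subalgebra k K) (hAO : A.toSubring ≤ O.toSubring)
    (hle : ringKrullDim A ≤ 3) (h3 : ringKrullDim (locAtCentre A.toSubring O) = 3) : ringKrullDim A = 3 := by
  haveI := isLocalization_locAtCentre hAO
  refine le_antisymm hle ?_
  rw [← h3]
  exact Literature.RingTheory.KrullDimension.ringKrullDim_le_of_isLocalization
    (subringCentre A.toSubring O hAO).primeCompl (locAtCentre A.toSubring O)


/-! ### (rev 6) Laurent-monomial algebra in a commutative group with zero (used in `K` and in the value group) -/

/-- `a ^ (Σ f) = ∏ a ^ f` for integer exponents, `a ≠ 0`. [folklore] -/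
theorem zpow_finsum {G₀ : Type} [CommGroupWithZero G₀] {ι : Type} [DecidableEq ι] {a : G₀} (ha : a ≠ 0)
    (s : Finset ι) (f : ι → ℤ) : a ^ (∑ i ∈ s, f i) = ∏ i ∈ s, a ^ f i := by
  induction s using Finset.induction_on with
  | empty => simp
  | insert i s hi ih => rw [Finset.sum_insert hi, Finset.prod_insert hi, zpow_add₀ ha, ih]

/-- `∏ zᵢ^{Cᵢ + Dᵢ} = ∏ zᵢ^{Cᵢ} · ∏ zᵢ^{Dᵢ}`. [folklore] -/
theorem prod_zpow_add {G₀ : Type} [CommGroupWithZero G₀] {ι : Type} [Fintype ι] {z : ι → G₀} (hz0 : ∀ i, z i ≠ 0)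
    (C D : ι → ℤ) : ∏ i, z i ^ (C i + D i) = (∏ i, z i ^ C i) * ∏ i, z i ^ D i := by
  rw [← Finset.prod_mul_distrib]
  exact Finset.prod_congr rfl fun i _ => zpow_add₀ (hz0 i) _ _

/-- `∏ zᵢ^{n·Cᵢ} = (∏ zᵢ^{Cᵢ})^n`. [folklore] -/
theorem prod_zpow_smul {G₀ : Type} [CommGroupWithZero G₀] {ι : Type} [Fintype ι] (z : ι → G₀)
    (n : ℤ) (C : ι → ℤ) : ∏ i, z i ^ (n * C i) = (∏ i, z i ^ C i) ^ n := by
  rw [← Finset.prod_zpow]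
  exact Finset.prod_congr rfl fun i _ => by rw [mul_comm, zpow_mul]

/-- `∏ᵢ zᵢ^{Σⱼ dⱼ cⱼᵢ} = ∏ⱼ (∏ᵢ zᵢ^{cⱼᵢ})^{dⱼ}`. [folklore] -/
theorem prod_zpow_lincomb {G₀ : Type} [CommGroupWithZero G₀] {ι κ : Type} [Fintype ι] [Fintype κ] [DecidableEq κ]
    {z : ι → G₀} (hz0 : ∀ i, z i ≠ 0) (d : κ → ℤ) (c : κ → ι → ℤ) :
    ∏ i, z i ^ (∑ j, d j * c j i) = ∏ j, (∏ i, z i ^ c j i) ^ d j := by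
  calc ∏ i, z i ^ (∑ j, d j * c j i) = ∏ i, ∏ j, (z i ^ c j i) ^ d j := by
        refine Finset.prod_congr rfl fun i _ => ?_
        rw [zpow_finsum (hz0 i)]
        exact Finset.prod_congr rfl fun j _ => by rw [mul_comm, zpow_mul]
    _ = ∏ j, ∏ i, (z i ^ c j i) ^ d j := Finset.prod_comm
    _ = ∏ j, (∏ i, z i ^ c j i) ^ d j := Finset.prod_congr rfl fun j _ => Finset.prod_zpow _ _ _

/-- `t ↦ t ^ p` is injective on a linearly ordered commutative group with zero (`p ≠ 0`) (census/PunchlineBits copy). [folklore] -/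
theorem pow_left_injective_of_ne_zero {Γ₀ : Type} [LinearOrderedCommGroupWithZero Γ₀] {p : ℕ} (hp : p ≠ 0)
    {a b : Γ₀} (h : a ^ p = b ^ p) : a = b := by
  rcases lt_trichotomy a b with hab | hab | hab
  · exact absurd h (ne_of_lt (pow_lt_pow_left₀ hab zero_le hp))
  · exact hab
  · exact absurd h.symm (ne_of_lt (pow_lt_pow_left₀ hab zero_le hp))


/-! ## §L THE PROOF OF PORT 3-L -/

/-! ### (rev 7) PORT 3-L split: (a) monomial values as weights, (b) the exponent lattice `L = pℤ³ + ℤeA + ℤeB` (membership, normal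
form, a `Fin 3`-basis), (c) two ABSTRACT lattice-chart lemmas (archimedean / two-level — pure ordered-group statements over the ✓ kit),
(d) the two-level data of a valuation ring with a proper coarsening, and the glue. -/

/-- **(3-L-a) values of monomials are products of the weights `v(wᵢ)`** (`v(zᵢ) = v(wᵢ)^p`, `x^p = α z^{eA}`, `y^p = β z^{eB}`,
`v α = v β = 1`): `v(z^C x^a y^b) = ∏ v(wᵢ)^{p Cᵢ + a eAᵢ + b eBᵢ}`.  PROVED. [folklore] -/
theorem valuation_monomial_eq_prod_weights (p : ℕ) [Fact p.Prime] {K : Type} [Field K] (O : ValuationSubring K) {x y : K}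
    (hx : x ≠ 0) (hy : y ≠ 0) (z : Fin 3 → K) (hz0 : ∀ i, z i ≠ 0) (w : Fin 3 → K) (hw0 : ∀ i, w i ≠ 0)
    (hwv : ∀ i, O.valuation (z i) = O.valuation (w i ^ p))
    (α β : K) (hα : O.valuation α = 1) (hβ : O.valuation β = 1) (eA eB : Fin 3 → ℤ)
    (hxA : x ^ p = α * ∏ i, z i ^ eA i) (hyB : y ^ p = β * ∏ i, z i ^ eB i) (C : Fin 3 → ℤ) (a b : ℕ) :
    O.valuation ((∏ i, z i ^ C i) * (x ^ a * y ^ b)) =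
      ∏ i, O.valuation (w i) ^ ((p : ℤ) * C i + (a : ℤ) * eA i + (b : ℤ) * eB i) := by
  classical
  have hp := (Fact.out : p.Prime)
  set V := O.valuation with hV
  have hVx : V x ≠ 0 := (Valuation.ne_zero_iff V).mpr hx
  have hVy : V y ≠ 0 := (Valuation.ne_zero_iff V).mpr hy
  have hVz : ∀ i, V (z i) ≠ 0 := fun i => (Valuation.ne_zero_iff V).mpr (hz0 i)
  have hVw : ∀ i, V (w i) ≠ 0 := fun i => (Valuation.ne_zero_iff V).mpr (hw0 i)
  have hZW : ∀ i, V (z i) = V (w i) ^ p := fun i => by rw [hwv i, map_pow]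
  -- `V x = ∏ V wᵢ ^ eAᵢ`, `V y = ∏ V wᵢ ^ eBᵢ` (unique `p`-th roots)
  have hroot : ∀ (t : K) (γ : K) (hγ : V γ = 1) (e : Fin 3 → ℤ), t ^ p = γ * ∏ i, z i ^ e i →
      V t = ∏ i, V (w i) ^ e i := by
    intro t γ hγ e ht
    apply pow_left_injective_of_ne_zero hp.ne_zero
    have h := congrArg V ht
    rw [map_pow, map_mul, hγ, one_mul, map_prod] at h
    rw [h, ← zpow_natCast (∏ i, V (w i) ^ e i), ← prod_zpow_smul]
    refine Finset.prod_congr rfl fun i _ => ?_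
    rw [map_zpow₀, hZW i, ← zpow_natCast, ← zpow_mul]
  have hX := hroot x α hα eA hxA
  have hY := hroot y β hβ eB hyB
  rw [map_mul, map_mul, map_pow, map_pow, map_prod, hX, hY, prod_zpow_add hVw, prod_zpow_add hVw, prod_zpow_smul,
    prod_zpow_smul, prod_zpow_smul]
  have hC : ∏ i, V (z i ^ C i) = (∏ i, V (w i) ^ C i) ^ (p : ℤ) := by
    rw [← prod_zpow_smul]
    refine Finset.prod_congr rfl fun i _ => ?_
    rw [map_zpow₀, hZW i, ← zpow_natCast, ← zpow_mul]
  rw [hC, zpow_natCast, zpow_natCast, zpow_natCast, mul_assoc]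

/-- **(3-L-b) membership in the exponent lattice** `L = pℤ³ + ℤ eA + ℤ eB`. PROVED. [folklore] -/
theorem mem_toricLattice_iff (p : ℤ) (eA eB ℓ : Fin 3 → ℤ) :
    ℓ ∈ Submodule.span ℤ (Set.range fun i : Fin 3 => (Pi.single i p : Fin 3 → ℤ)) ⊔ Submodule.span ℤ {eA, eB} ↔
      ∃ (C : Fin 3 → ℤ) (a b : ℤ), ∀ i, ℓ i = p * C i + a * eA i + b * eB i := by
  classical
  have hsum : ∀ (C : Fin 3 → ℤ) (i : Fin 3), (∑ j, C j • (Pi.single j p : Fin 3 → ℤ)) i = p * C i := by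
    intro C i
    rw [Finset.sum_apply, Finset.sum_eq_single i]
    · rw [Pi.smul_apply, Pi.single_eq_same, smul_eq_mul, mul_comm]
    · intro j _ hj
      rw [Pi.smul_apply, Pi.single_eq_of_ne' hj, smul_zero]
    · intro h
      exact absurd (Finset.mem_univ i) h
  constructor
  · intro h
    obtain ⟨u, hu, v, hv, huv⟩ := Submodule.mem_sup.mp h
    obtain ⟨C, hC⟩ := (Submodule.mem_span_range_iff_exists_fun ℤ).mp hu
    obtain ⟨a, b, hab⟩ := Submodule.mem_span_pair.mp hv
    refine ⟨C, a, b, fun i => ?_⟩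
    rw [← huv, ← hC, ← hab, Pi.add_apply, hsum, Pi.add_apply, Pi.smul_apply, Pi.smul_apply, smul_eq_mul, smul_eq_mul]
    ring
  · rintro ⟨C, a, b, h⟩
    have hℓ : ℓ = (∑ j, C j • (Pi.single j p : Fin 3 → ℤ)) + (a • eA + b • eB) := by
      funext i
      rw [Pi.add_apply, hsum, Pi.add_apply, Pi.smul_apply, Pi.smul_apply, smul_eq_mul, smul_eq_mul, h i]
      ring
    rw [hℓ]
    exact Submodule.add_mem_sup
      (Submodule.sum_mem _ fun j _ => Submodule.smul_mem _ _ (Submodule.subset_span ⟨j, rfl⟩))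
      (Submodule.mem_span_pair.mpr ⟨a, b, rfl⟩)

/-- **(3-L-b) normal form**: every `p·C + a·eA + b·eB` can be rewritten with `0 ≤ a, b < p`. PROVED. [folklore] -/
theorem toricLattice_normalForm (p : ℕ) (hp : 0 < p) (eA eB : Fin 3 → ℤ) (C : Fin 3 → ℤ) (a b : ℤ) :
    ∃ (C' : Fin 3 → ℤ) (a' b' : ℕ), a' < p ∧ b' < p ∧
      ∀ i, (p : ℤ) * C i + a * eA i + b * eB i = (p : ℤ) * C' i + (a' : ℤ) * eA i + (b' : ℤ) * eB i := by
  have hp0 : (p : ℤ) ≠ 0 := by exact_mod_cast hp.ne'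
  have hpp : (0 : ℤ) < p := by exact_mod_cast hp
  obtain ⟨a₀, ha₀⟩ : ∃ a₀ : ℕ, (a₀ : ℤ) = a % p := ⟨(a % p).toNat, Int.toNat_of_nonneg (Int.emod_nonneg a hp0)⟩
  obtain ⟨b₀, hb₀⟩ : ∃ b₀ : ℕ, (b₀ : ℤ) = b % p := ⟨(b % p).toNat, Int.toNat_of_nonneg (Int.emod_nonneg b hp0)⟩
  have ha : a = p * (a / p) + a₀ := by rw [ha₀]; exact (Int.mul_ediv_add_emod a p).symm
  have hb : b = p * (b / p) + b₀ := by rw [hb₀]; exact (Int.mul_ediv_add_emod b p).symm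
  refine ⟨fun i => C i + a / p * eA i + b / p * eB i, a₀, b₀, ?_, ?_, fun i => ?_⟩
  · have h := Int.emod_lt_of_pos a hpp
    rw [← ha₀] at h
    exact_mod_cast h
  · have h := Int.emod_lt_of_pos b hpp
    rw [← hb₀] at h
    exact_mod_cast h
  · linear_combination (eA i) * ha + (eB i) * hb

/-- **(3-L-b) the exponent lattice is free of rank 3** (`pℤ³ ≤ L ≤ ℤ³`). PROVED. [folklore] -/
theorem toricLattice_basis (p : ℕ) (hp : 0 < p) (eA eB : Fin 3 → ℤ) :
    Nonempty (Module.Basis (Fin 3) ℤ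
      ↥(Submodule.span ℤ (Set.range fun i : Fin 3 => (Pi.single i (p : ℤ) : Fin 3 → ℤ)) ⊔ Submodule.span ℤ {eA, eB})) := by
  classical
  set L := Submodule.span ℤ (Set.range fun i : Fin 3 => (Pi.single i (p : ℤ) : Fin 3 → ℤ)) ⊔ Submodule.span ℤ {eA, eB} with hL
  obtain ⟨n, ⟨b'⟩⟩ := Submodule.nonempty_basis_of_pid (Pi.basisFun ℤ (Fin 3)) L
  have hp0 : (p : ℤ) ≠ 0 := by exact_mod_cast hp.ne'
  -- three independent vectors `p·δᵢ ∈ L`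
  have hmem : ∀ i : Fin 3, (Pi.single i (p : ℤ) : Fin 3 → ℤ) ∈ L := fun i =>
    Submodule.mem_sup_left (Submodule.subset_span ⟨i, rfl⟩)
  have hli : LinearIndependent ℤ (fun i : Fin 3 => (⟨Pi.single i (p : ℤ), hmem i⟩ : L)) := by
    apply LinearIndependent.of_comp L.subtype
    rw [Fintype.linearIndependent_iff]
    intro g hg i
    have h := congrArg (fun v : Fin 3 → ℤ => v i) hg
    simp only [Function.comp_apply, Submodule.coe_subtype, Finset.sum_apply, Pi.smul_apply, Pi.zero_apply, smul_eq_mul,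
      Pi.single_apply, mul_ite, mul_zero, Finset.sum_ite_eq, Finset.mem_univ, if_true] at h
    exact (mul_eq_zero.mp h).resolve_right hp0
  have h3 : Module.finrank ℤ L = 3 := by
    refine le_antisymm ?_ ?_
    · exact (Submodule.finrank_le L).trans (Module.finrank_fin_fun ℤ).le
    · have h := hli.fintype_card_le_finrank
      rwa [Fintype.card_fin] at h
  have hn : n = 3 := by
    have h := Module.finrank_eq_card_basis b'
    rw [Fintype.card_fin] at h
    omega
  exact ⟨b'.reindex (finCongr hn)⟩

/-- **Read-out, rank-one image (`ρ = 1`)**: a basis `e` with one positive vector `e i₀` carrying the whole weight. [folklore] -/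
theorem readout_rank_one {L : Type} [AddCommGroup L] {W : Type} [AddCommGroup W] [LinearOrder W] [IsOrderedAddMonoid W]
    (φ : L →+ W) (F : Finset L) (e : Module.Basis (Fin 3) ℤ L) (i₀ : Fin 3) (hpos : 0 < φ (e i₀))
    (hker : ∀ i, i ≠ i₀ → φ (e i) = 0) (hposc : ∀ f ∈ F, 0 < e.repr f i₀) (hzero : ∀ f : L, φ f = 0 → e.repr f i₀ = 0) :
    ∃ (ρ : ℕ), (ρ = 1 ∨ ρ = 2) ∧ ∃ M : Fin 3 → L,
      (∀ j : Fin 3, (j : ℕ) < ρ → 0 < φ (M j)) ∧ (∀ j : Fin 3, ρ ≤ (j : ℕ) → φ (M j) = 0) ∧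
      (∀ f ∈ F, ∃ d : Fin 3 → ℤ, f = ∑ j, d j • M j ∧ (∀ j : Fin 3, (j : ℕ) < ρ → 0 ≤ d j) ∧
        ∃ j : Fin 3, (j : ℕ) < ρ ∧ 0 < d j) ∧
      (∀ f : L, φ f = 0 → ∃ d : Fin 3 → ℤ, f = ∑ j, d j • M j ∧ ∀ j : Fin 3, (j : ℕ) < ρ → d j = 0) := by
  classical
  -- a permutation `σ` of `Fin 3` with `σ 0 = i₀`; the chart is `e ∘ σ`
  let σ : Equiv.Perm (Fin 3) := Equiv.swap 0 i₀
  have hσ0 : σ 0 = i₀ := Equiv.swap_apply_left 0 i₀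
  have hσj : ∀ j : Fin 3, j ≠ 0 → σ j ≠ i₀ := fun j hj h => hj (σ.injective (h.trans hσ0.symm))
  have hsum : ∀ f : L, f = ∑ j, e.repr f (σ j) • e (σ j) := by
    intro f
    rw [Equiv.sum_comp σ (fun i => e.repr f i • e i)]
    exact (e.sum_repr f).symm
  have hj0 : ∀ j : Fin 3, (j : ℕ) < 1 → j = 0 := fun j hj => Fin.ext (by omega)
  have hj1 : ∀ j : Fin 3, 1 ≤ (j : ℕ) → j ≠ 0 := fun j hj h => by subst h; simp at hj
  refine ⟨1, Or.inl rfl, fun j => e (σ j), ?_, ?_, ?_, ?_⟩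
  · intro j hj
    obtain rfl := hj0 j hj
    show 0 < φ (e (σ 0))
    rw [hσ0]
    exact hpos
  · intro j hj
    exact hker _ (hσj j (hj1 j hj))
  · intro f hf
    refine ⟨fun j => e.repr f (σ j), hsum f, fun j hj => ?_, ⟨0, Nat.zero_lt_one, ?_⟩⟩
    · obtain rfl := hj0 j hj
      show 0 ≤ e.repr f (σ 0)
      rw [hσ0]
      exact (hposc f hf).le
    · show 0 < e.repr f (σ 0)
      rw [hσ0]
      exact hposc f hf
  · intro f hf
    refine ⟨fun j => e.repr f (σ j), hsum f, fun j hj => ?_⟩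
    obtain rfl := hj0 j hj
    show e.repr f (σ 0) = 0
    rw [hσ0]
    exact hzero f hf

/-- **Read-out, positive plane (`ρ = 2`)**: the unimodular refinement `(m₁, m₂)` of the positive plane plus the kernel vector `e 2`.
[folklore] -/
theorem readout_rank_two {L : Type} [AddCommGroup L] {W : Type} [AddCommGroup W] [LinearOrder W] [IsOrderedAddMonoid W]
    (φ : L →+ W) (F : Finset L) (e : Module.Basis (Fin 3) ℤ L) (m₁ m₂ : L) (a b' c d : ℤ)
    (he2 : φ (e 2) = 0) (hm₁ : 0 < φ m₁) (hm₂ : 0 < φ m₂)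
    (hkc : ∀ f : L, φ f = 0 → e.repr f 0 = 0 ∧ e.repr f 1 = 0)
    (hFc : ∀ f ∈ F, f = (e.repr f 0 * a + e.repr f 1 * c) • m₁ + (e.repr f 0 * b' + e.repr f 1 * d) • m₂ + e.repr f 2 • e 2 ∧
      0 ≤ e.repr f 0 * a + e.repr f 1 * c ∧ 0 ≤ e.repr f 0 * b' + e.repr f 1 * d ∧
      (0 < e.repr f 0 * a + e.repr f 1 * c ∨ 0 < e.repr f 0 * b' + e.repr f 1 * d)) :
    ∃ (ρ : ℕ), (ρ = 1 ∨ ρ = 2) ∧ ∃ M : Fin 3 → L,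
      (∀ j : Fin 3, (j : ℕ) < ρ → 0 < φ (M j)) ∧ (∀ j : Fin 3, ρ ≤ (j : ℕ) → φ (M j) = 0) ∧
      (∀ f ∈ F, ∃ d : Fin 3 → ℤ, f = ∑ j, d j • M j ∧ (∀ j : Fin 3, (j : ℕ) < ρ → 0 ≤ d j) ∧
        ∃ j : Fin 3, (j : ℕ) < ρ ∧ 0 < d j) ∧
      (∀ f : L, φ f = 0 → ∃ d : Fin 3 → ℤ, f = ∑ j, d j • M j ∧ ∀ j : Fin 3, (j : ℕ) < ρ → d j = 0) := by
  classical
  refine ⟨2, Or.inr rfl, ![m₁, m₂, e 2], ?_, ?_, ?_, ?_⟩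
  · intro j hj
    fin_cases j
    · exact hm₁
    · exact hm₂
    · simp at hj
  · intro j hj
    fin_cases j
    · simp at hj
    · simp at hj
    · exact he2
  · intro f hf
    obtain ⟨hf', h0, h1, hpos⟩ := hFc f hf
    refine ⟨![e.repr f 0 * a + e.repr f 1 * c, e.repr f 0 * b' + e.repr f 1 * d, e.repr f 2], ?_, ?_, ?_⟩
    · rw [Fin.sum_univ_three]
      exact hf'
    · intro j hj
      fin_cases j
      · exact h0
      · exact h1
      · simp at hj
    · rcases hpos with h | h
      · exact ⟨0, by decide, h⟩
      · exact ⟨1, by decide, h⟩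
  · intro f hf
    obtain ⟨h0, h1⟩ := hkc f hf
    refine ⟨![0, 0, e.repr f 2], ?_, ?_⟩
    · rw [Fin.sum_univ_three]
      show f = (0 : ℤ) • m₁ + (0 : ℤ) • m₂ + e.repr f 2 • e 2
      rw [zero_smul, zero_smul, zero_add, zero_add]
      conv_lhs => rw [← e.sum_repr f, Fin.sum_univ_three, h0, h1, zero_smul, zero_smul, zero_add, zero_add]
    · intro j hj
      fin_cases j
      · rfl
      · rfl
      · simp at hj

/-- Two independent kernel vectors of `φ` from pairwise `ℤ`-dependence of the weights `φ (b i)` (`W` torsion-free). [folklore] -/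
theorem exists_indep_kernel_pair {L : Type} [AddCommGroup L] (b : Module.Basis (Fin 3) ℤ L)
    {W : Type} [AddCommGroup W] [LinearOrder W] [IsOrderedAddMonoid W] (φ : L →+ W)
    (hdep : ∀ i j : Fin 3, ∃ s t : ℤ, (s ≠ 0 ∨ t ≠ 0) ∧ s • φ (b i) + t • φ (b j) = 0) :
    ∃ x y : L, φ x = 0 ∧ φ y = 0 ∧ ∀ s t : ℤ, s • x + t • y = 0 → s = 0 ∧ t = 0 := by
  classical
  have hφ2 : ∀ (s t : ℤ) (i j : Fin 3), φ (s • b i + t • b j) = s • φ (b i) + t • φ (b j) := by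
    intro s t i j
    rw [map_add, map_zsmul, map_zsmul]
  -- torsion: `s • w = 0`, `s ≠ 0` ⟹ `w = 0`
  have htor : ∀ (s : ℤ) (w : W), s ≠ 0 → s • w = 0 → w = 0 := by
    intro s w hs h
    rcases lt_trichotomy w 0 with hlt | heq | hgt
    · rcases lt_or_gt_of_ne hs with hs' | hs'
      · have h' := zsmul_pos (neg_pos.mpr hlt) (neg_pos.mpr hs')
        rw [smul_neg, neg_zsmul, neg_neg] at h'
        exact absurd h (ne_of_gt h')
      · have h' := zsmul_pos (neg_pos.mpr hlt) hs'
        rw [smul_neg] at h'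
        exact absurd h (ne_of_lt (neg_pos.mp h'))
    · exact heq
    · rcases lt_or_gt_of_ne hs with hs' | hs'
      · have h' := zsmul_pos hgt (neg_pos.mpr hs')
        rw [neg_zsmul] at h'
        exact absurd h (ne_of_lt (neg_pos.mp h'))
      · exact absurd h (ne_of_gt (zsmul_pos hgt hs'))
  by_cases h0 : φ (b 0) = 0
  · obtain ⟨s, t, hst, hrel⟩ := hdep 1 2
    refine ⟨b 0, s • b 1 + t • b 2, h0, by rw [hφ2]; exact hrel, fun u v huv => ?_⟩
    have hc0 := congrArg (fun z => b.repr z 0) huv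
    have hc1 := congrArg (fun z => b.repr z 1) huv
    have hc2 := congrArg (fun z => b.repr z 2) huv
    simp only [smul_add, ← mul_smul, map_add, map_zsmul, Module.Basis.repr_self, Finsupp.coe_add, Finsupp.coe_smul,
      Pi.add_apply, Pi.smul_apply, Finsupp.single_apply, smul_eq_mul, map_zero, Finsupp.coe_zero, Pi.zero_apply] at hc0 hc1 hc2
    simp only [show ((2 : Fin 3) = 0) ↔ False from by decide, show ((2 : Fin 3) = 1) ↔ False from by decide,
      show ((0 : Fin 3) = 2) ↔ False from by decide, show ((1 : Fin 3) = 2) ↔ False from by decide,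
      show ((0 : Fin 3) = 1) ↔ False from by decide, show ((1 : Fin 3) = 0) ↔ False from by decide,
      if_false, if_true, mul_one, mul_zero, add_zero, zero_add] at hc0 hc1 hc2
    refine ⟨hc0, ?_⟩
    rcases hst with hs | ht
    · exact (mul_eq_zero.mp hc1).resolve_right hs
    · exact (mul_eq_zero.mp hc2).resolve_right ht
  · obtain ⟨s₁, t₁, hst₁, hrel₁⟩ := hdep 0 1
    obtain ⟨s₂, t₂, hst₂, hrel₂⟩ := hdep 0 2
    have ht₁ : t₁ ≠ 0 := by
      rintro rfl
      rw [zero_smul, add_zero] at hrel₁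
      have hs₁ : s₁ ≠ 0 := hst₁.resolve_right (fun h => h rfl)
      exact h0 (htor s₁ _ hs₁ hrel₁)
    have ht₂ : t₂ ≠ 0 := by
      rintro rfl
      rw [zero_smul, add_zero] at hrel₂
      have hs₂ : s₂ ≠ 0 := hst₂.resolve_right (fun h => h rfl)
      exact h0 (htor s₂ _ hs₂ hrel₂)
    refine ⟨s₁ • b 0 + t₁ • b 1, s₂ • b 0 + t₂ • b 2, by rw [hφ2]; exact hrel₁, by rw [hφ2]; exact hrel₂,
      fun u v huv => ?_⟩
    have hc1 := congrArg (fun z => b.repr z 1) huv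
    have hc2 := congrArg (fun z => b.repr z 2) huv
    simp only [smul_add, ← mul_smul, map_add, map_zsmul, Module.Basis.repr_self, Finsupp.coe_add, Finsupp.coe_smul,
      Pi.add_apply, Pi.smul_apply, Finsupp.single_apply, smul_eq_mul, map_zero, Finsupp.coe_zero, Pi.zero_apply] at hc1 hc2
    simp only [show ((2 : Fin 3) = 1) ↔ False from by decide,
      show ((0 : Fin 3) = 2) ↔ False from by decide, show ((1 : Fin 3) = 2) ↔ False from by decide,
      show ((0 : Fin 3) = 1) ↔ False from by decide,
      if_false, if_true, mul_one, mul_zero, add_zero, zero_add] at hc1 hc2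
    exact ⟨(mul_eq_zero.mp hc1).resolve_right ht₁, (mul_eq_zero.mp hc2).resolve_right ht₂⟩

/-- **(3-L-c1) ABSTRACT LATTICE CHART, archimedean weights** — the ✓ `toric_lemma_classB` (`Lens5_UnimodularRefinement.lean` rev 9
e40b13a8bffb :881, kernel clause included) read out as a chart `M : Fin 3 → L` with `ρ ∈ {1,2}` positive vectors: weights `> 0` on
`M j, j < ρ`, `= 0` on `M j, ρ ≤ j`; every `f ∈ F` has integer coordinates on `M` that are `≥ 0` on the positive block and `> 0`
somewhere there; every weight-zero `f` has coordinates vanishing on the positive block.  (Read-out: branch 1 ↦ `ρ = 2`, `M = (m₁, m₂,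
e 2)`, `d = ((r₀a + r₁c), (r₀b' + r₁d), r₂)`; branch 2 ↦ `ρ = 1`, `M = (e i₀, e i₁, e i₂)`, `d = e.repr` permuted.)  PROVED (rev 7). [folklore] -/
theorem latticeChart_of_archimedean {L : Type} [AddCommGroup L] (b : Module.Basis (Fin 3) ℤ L)
    {W : Type} [AddCommGroup W] [LinearOrder W] [IsOrderedAddMonoid W] [Archimedean W] (φ : L →+ W)
    (hrel : ∃ x : L, x ≠ 0 ∧ φ x = 0) (hne : ∃ x : L, φ x ≠ 0) (F : Finset L) (hF : ∀ f ∈ F, 0 < φ f) :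
    ∃ (ρ : ℕ), (ρ = 1 ∨ ρ = 2) ∧ ∃ M : Fin 3 → L,
      (∀ j : Fin 3, (j : ℕ) < ρ → 0 < φ (M j)) ∧ (∀ j : Fin 3, ρ ≤ (j : ℕ) → φ (M j) = 0) ∧
      (∀ f ∈ F, ∃ d : Fin 3 → ℤ, f = ∑ j, d j • M j ∧ (∀ j : Fin 3, (j : ℕ) < ρ → 0 ≤ d j) ∧
        ∃ j : Fin 3, (j : ℕ) < ρ ∧ 0 < d j) ∧
      (∀ f : L, φ f = 0 → ∃ d : Fin 3 → ℤ, f = ∑ j, d j • M j ∧ ∀ j : Fin 3, (j : ℕ) < ρ → d j = 0) := by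
  classical
  rcases UnimodularRefinement.toric_lemma_classB b φ hrel hne F hF with
    ⟨e, m₁, m₂, a, b', c, d, he2, hdet, he0, he1, hm₁, hm₂, hkc, hFc⟩ | ⟨e, i₀, hpos, hker, hrepr, hposc⟩
  · exact readout_rank_two φ F e m₁ m₂ a b' c d he2 hm₁ hm₂ hkc fun f hf =>
      let h := hFc f hf
      ⟨h.1, h.2.1.le, h.2.2.le, Or.inl h.2.1⟩
  · refine readout_rank_one φ F e i₀ hpos hker (fun f hf => hposc f (hF f hf)) fun f hf => ?_
    have h := hrepr f
    rw [hf] at h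
    rcases lt_trichotomy (e.repr f i₀) 0 with hlt | heq | hgt
    · refine absurd h.symm (ne_of_lt ?_)
      have h' := zsmul_pos hpos (neg_pos.mpr hlt)
      rw [neg_zsmul] at h'
      exact neg_pos.mp h'
    · exact heq
    · exact absurd h.symm (ne_of_gt (zsmul_pos hpos hgt))

/-- **(3-L-c2) ABSTRACT LATTICE CHART, two-level weights** — the same chart when the weight group `W` carries a monotone `ψ : W → W₁`
with `W₁` and `ker ψ` both of "rank ≤ 1" (any two elements `ℤ`-dependent): CASE 1 (two independent kernel vectors of `φ`) by the ✓
`exists_kernel_adapted_basis_of_rank_two_ker_pos` (`ρ = 1`); CASE 2: then `ψ ∘ φ ≠ 0` AUTOMATICALLY (else `φ(bᵢ) ∈ ker ψ` are pairwise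
dependent, giving CASE 1), so the ✓ `exists_two_level_reading` (:1121) yields `φ₁, φ₂ : L →+ ℤ` with `0 < φ ⟺` lex-positive and `φ = 0
⟺ φ₁ = φ₂ = 0`, and the ✓ `toric_lemma_classC` (:930) is read out as in (3-L-c1).  No counting argument / (P2) is needed for `hne`.
PROVED (rev 7). [folklore] -/
theorem latticeChart_of_twoLevel {L : Type} [AddCommGroup L] (b : Module.Basis (Fin 3) ℤ L)
    {W W₁ : Type} [AddCommGroup W] [LinearOrder W] [IsOrderedAddMonoid W]
    [AddCommGroup W₁] [LinearOrder W₁] [IsOrderedAddMonoid W₁] (φ : L →+ W) (ψ : W →+ W₁) (hψ : Monotone ψ)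
    (hW₁ : ∀ w w' : W₁, ∃ s t : ℤ, (s ≠ 0 ∨ t ≠ 0) ∧ s • w + t • w' = 0)
    (hΔ : ∀ w w' : W, ψ w = 0 → ψ w' = 0 → ∃ s t : ℤ, (s ≠ 0 ∨ t ≠ 0) ∧ s • w + t • w' = 0)
    (hrel : ∃ x : L, x ≠ 0 ∧ φ x = 0) (hne : ∃ x : L, φ x ≠ 0) (F : Finset L) (hF : ∀ f ∈ F, 0 < φ f) :
    ∃ (ρ : ℕ), (ρ = 1 ∨ ρ = 2) ∧ ∃ M : Fin 3 → L,
      (∀ j : Fin 3, (j : ℕ) < ρ → 0 < φ (M j)) ∧ (∀ j : Fin 3, ρ ≤ (j : ℕ) → φ (M j) = 0) ∧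
      (∀ f ∈ F, ∃ d : Fin 3 → ℤ, f = ∑ j, d j • M j ∧ (∀ j : Fin 3, (j : ℕ) < ρ → 0 ≤ d j) ∧
        ∃ j : Fin 3, (j : ℕ) < ρ ∧ 0 < d j) ∧
      (∀ f : L, φ f = 0 → ∃ d : Fin 3 → ℤ, f = ∑ j, d j • M j ∧ ∀ j : Fin 3, (j : ℕ) < ρ → d j = 0) := by
  classical
  by_cases h2 : ∃ x y : L, φ x = 0 ∧ φ y = 0 ∧ ∀ s t : ℤ, s • x + t • y = 0 → s = 0 ∧ t = 0
  · -- CASE 1: the image of `φ` has rank one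
    obtain ⟨e, i₀, hpos, hker, hrepr, hposc⟩ :=
      UnimodularRefinement.exists_kernel_adapted_basis_of_rank_two_ker_pos b φ hne h2
    refine readout_rank_one φ F e i₀ hpos hker (fun f hf => hposc f (hF f hf)) fun f hf => ?_
    have h := hrepr f
    rw [hf] at h
    rcases lt_trichotomy (e.repr f i₀) 0 with hlt | heq | hgt
    · refine absurd h.symm (ne_of_lt ?_)
      have h' := zsmul_pos hpos (neg_pos.mpr hlt)
      rw [neg_zsmul] at h'
      exact neg_pos.mp h'
    · exact heq
    · exact absurd h.symm (ne_of_gt (zsmul_pos hpos hgt))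
  · -- CASE 2: `ψ ∘ φ ≠ 0` automatically, then the two-level reading and the class (C) lattice lemma
    have hneχ : ∃ x : L, ψ (φ x) ≠ 0 := by
      by_contra hall
      push Not at hall
      exact h2 (exists_indep_kernel_pair b φ fun i j => hΔ _ _ (hall _) (hall _))
    obtain ⟨φ₁, φ₂, hchar⟩ := UnimodularRefinement.exists_two_level_reading b φ ψ hψ hW₁ hΔ hneχ
    have hrel' : ∃ x : L, x ≠ 0 ∧ φ₁ x = 0 ∧ φ₂ x = 0 := by
      obtain ⟨x, hx0, hx⟩ := hrel
      exact ⟨x, hx0, ((hchar x).2).mp hx⟩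
    have hne' : ∃ x : L, φ₁ x ≠ 0 ∨ φ₂ x ≠ 0 := by
      obtain ⟨x, hx⟩ := hne
      refine ⟨x, ?_⟩
      by_contra h
      push Not at h
      exact hx (((hchar x).2).mpr h)
    have hF' : ∀ f ∈ F, 0 < φ₁ f ∨ (φ₁ f = 0 ∧ 0 < φ₂ f) := fun f hf => ((hchar f).1).mp (hF f hf)
    rcases UnimodularRefinement.toric_lemma_classC b φ₁ φ₂ hrel' hne' F hF' with
      ⟨e, m₁, m₂, a, b', c, d, he2, hdet, he0, he1, hm₁, hm₂, hkc, hFc⟩ | ⟨e, i₀, hpos, hker, hrepr, hposc⟩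
    · refine readout_rank_two φ F e m₁ m₂ a b' c d (((hchar _).2).mpr he2) (((hchar _).1).mpr (Or.inl hm₁))
        (((hchar _).1).mpr (Or.inr hm₂)) (fun f hf => ?_) fun f hf => ?_
      · have h := ((hchar f).2).mp hf
        exact hkc f h.1 h.2
      · obtain ⟨h1, h2', h3, h4⟩ := hFc f hf
        exact ⟨h1, h2', h3, h4.imp id And.right⟩
    · refine readout_rank_one φ F e i₀ (((hchar _).1).mpr hpos) (fun i hi => ((hchar _).2).mpr (hker i hi))
        (fun f hf => hposc f (hF' f hf)) fun f hf => ?_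
      have h := ((hchar f).2).mp hf
      obtain ⟨h1, h2'⟩ := hrepr f
      rcases hpos with hp1 | ⟨-, hp2⟩
      · rw [h.1] at h1
        exact (mul_eq_zero.mp h1.symm).resolve_right hp1.ne'
      · rw [h.2] at h2'
        exact (mul_eq_zero.mp h2'.symm).resolve_right hp2.ne'

/-- **(3-L-d) two-level data of a valuation ring with a PROPER COARSENING** (class (C)): if some valuation ring lies strictly between
`O` and `K` and `rank_ℤ Γ_O ≤ 2`, there is a coarsening `O₁` with the monotone units map `ψ` of `ValuationSubring.mapOfLE O O₁` such that
any two values in `Γ_{O₁}` and any two elements of `ker ψ` are `ℤ`-dependent (✓ `pair_dependent_of_rank_le_two_of_surjective`, ✓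
`ker_pair_dependent_of_rank_le_two`; `ker ψ ∋` the class of a unit of `O₁` outside `O` (`nonunits_le_nonunits`), `ψ ≠ 0` at an
element outside `O₁`).  PROVED. [folklore] -/
theorem valueGroup_twoLevel_data {K : Type} [Field K] (O : ValuationSubring K)
    (hW : Module.rank ℤ (Additive (ValuationSubring.ValueGroup O)ˣ) ≤ 2)
    (hB : ¬ ∀ O₁ : ValuationSubring K, O ≤ O₁ → O₁ = O ∨ O₁ = ⊤) :
    ∃ (O₁ : ValuationSubring K) (ψ : Additive (ValuationSubring.ValueGroup O)ˣ →+ Additive (ValuationSubring.ValueGroup O₁)ˣ),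
      Monotone ψ ∧
      (∀ w w' : Additive (ValuationSubring.ValueGroup O₁)ˣ, ∃ s t : ℤ, (s ≠ 0 ∨ t ≠ 0) ∧ s • w + t • w' = 0) ∧
      (∀ w w' : Additive (ValuationSubring.ValueGroup O)ˣ, ψ w = 0 → ψ w' = 0 →
        ∃ s t : ℤ, (s ≠ 0 ∨ t ≠ 0) ∧ s • w + t • w' = 0) := by
  classical
  push Not at hB
  obtain ⟨O₁, h, hne, hnetop⟩ := hB
  let f : O.ValueGroup →*₀ O₁.ValueGroup := O.mapOfLE O₁ h
  let ψm : (O.ValueGroup)ˣ →* (O₁.ValueGroup)ˣ := Units.map f.toMonoidHom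
  have hψm : ∀ u : (O.ValueGroup)ˣ, ((ψm u : (O₁.ValueGroup)ˣ) : O₁.ValueGroup) = f (u : O.ValueGroup) := fun u => rfl
  have hfval : ∀ x : K, f (O.valuation x) = O₁.valuation x := fun x => ValuationSubring.mapOfLE_valuation_apply O O₁ h x
  let ψ : Additive (O.ValueGroup)ˣ →+ Additive (O₁.ValueGroup)ˣ := MonoidHom.toAdditive ψm
  have hψ : ∀ a, ψ a = Additive.ofMul (ψm (Additive.toMul a)) := fun _ => rfl
  -- units attached to non-zero elements of `K`
  have hu : ∀ x : K, x ≠ 0 → ∃ u : (O.ValueGroup)ˣ, (u : O.ValueGroup) = O.valuation x := fun x hx =>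
    ⟨Units.mk0 (O.valuation x) ((Valuation.ne_zero_iff _).mpr hx), Units.val_mk0 _⟩
  have hψu : ∀ (x : K) (u : (O.ValueGroup)ˣ), (u : O.ValueGroup) = O.valuation x →
      ((ψm u : (O₁.ValueGroup)ˣ) : O₁.ValueGroup) = O₁.valuation x := by
    intro x u hux
    rw [hψm, hux, hfval]
  refine ⟨O₁, ψ, ?_, ?_, ?_⟩
  · -- monotone
    intro a b hab
    rw [hψ, hψ, Additive.ofMul_le, ← Units.val_le_val, hψm, hψm]
    exact ValuationSubring.monotone_mapOfLE O O₁ h (Units.val_le_val.mpr (Additive.toMul_le.mpr hab))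
  · -- (hW₁): surjectivity + a non-zero kernel element (a unit of `O₁` outside `O`)
    have hsurj : Function.Surjective ψ := by
      intro b
      obtain ⟨x, hx⟩ := O₁.valuation_surjective ((Additive.toMul b : (O₁.ValueGroup)ˣ) : O₁.ValueGroup)
      have hx0 : x ≠ 0 := fun h0 => (Additive.toMul b).ne_zero (by rw [← hx, h0, map_zero])
      obtain ⟨u, hux⟩ := hu x hx0
      refine ⟨Additive.ofMul u, ?_⟩
      rw [hψ]
      refine congrArg Additive.ofMul (Units.ext ?_) |>.trans (ofMul_toMul b)
      rw [toMul_ofMul, hψu x u hux, hx]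
    have hker : ∃ zW : Additive (O.ValueGroup)ˣ, zW ≠ 0 ∧ ψ zW = 0 := by
      obtain ⟨x, hx₁, hxO⟩ := SetLike.exists_of_lt (lt_of_le_of_ne h (Ne.symm hne))
      have hx0 : x ≠ 0 := fun h0 => hxO (h0 ▸ O.zero_mem)
      obtain ⟨u, hux⟩ := hu x hx0
      have hvO : O.valuation x ≠ 1 := fun h1 => hxO ((ValuationSubring.valuation_le_one_iff O x).mp h1.le)
      have hv₁ : O₁.valuation x = 1 := by
        refine le_antisymm ((ValuationSubring.valuation_le_one_iff O₁ x).mpr hx₁) (not_lt.mp fun hlt => hxO ?_)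
        have hxn : x ∈ O.nonunits := (ValuationSubring.nonunits_le_nonunits.mpr h) (O₁.mem_nonunits_iff.mpr hlt)
        exact (ValuationSubring.valuation_le_one_iff O x).mp (O.mem_nonunits_iff.mp hxn).le
      refine ⟨Additive.ofMul u, ?_, ?_⟩
      · intro h0
        apply hvO
        have hu1 : u = 1 := Additive.ofMul.injective (h0.trans ofMul_one.symm)
        rw [← hux, hu1, Units.val_one]
      · rw [hψ, toMul_ofMul, ← ofMul_one]
        exact congrArg Additive.ofMul (Units.ext (by rw [hψu x u hux, hv₁, Units.val_one]))
    exact RankOneArchimedean.pair_dependent_of_rank_le_two_of_surjective hW ψ hsurj hker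
  · -- (hΔ): a non-zero value of `ψ` (an element outside `O₁`)
    have hneψ : ∃ a : Additive (O.ValueGroup)ˣ, ψ a ≠ 0 := by
      obtain ⟨x, -, hx₁⟩ := SetLike.exists_of_lt (lt_top_iff_ne_top.mpr hnetop)
      have hx0 : x ≠ 0 := fun h0 => hx₁ (h0 ▸ O₁.zero_mem)
      obtain ⟨u, hux⟩ := hu x hx0
      have hv₁ : O₁.valuation x ≠ 1 := fun h1 => hx₁ ((ValuationSubring.valuation_le_one_iff O₁ x).mp h1.le)
      refine ⟨Additive.ofMul u, fun h0 => hv₁ ?_⟩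
      rw [hψ, toMul_ofMul, ← ofMul_one] at h0
      have h1 : ψm u = 1 := Additive.ofMul.injective h0
      rw [← hψu x u hux, h1, Units.val_one]
    exact RankOneArchimedean.ker_pair_dependent_of_rank_le_two hW ψ hneψ

/-- **PORT 3-L (the LATTICE half of PORT 3: the exponent-level toric chart).**  PROVED (rev 7) from (3-L-a,b,d) and the two abstract
lattice-chart lemmas (3-L-c1/c2): weights `ωᵢ = v(wᵢ)` in `W = Additive (Γ_O)ˣ`, `Ω ℓ = Σ ℓᵢ • ωᵢ` (so `v(z^C x^a y^b) =` the value of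
`Ω(θ(C,a,b))` by (3-L-a)), `φ = −Ω|L` on the exponent lattice `L` with a `Fin 3`-basis (3-L-b), `hrel` from `rank_ℤ W ≤ 2` (✓ R1A kit
`ratRank_le_two_of_stub` + `exists_ne_zero_map_eq_zero_of_rank_le_two`), `hne` from `v(z₀) < 1`, `F = {p·δᵢ} ∪ {θ e : e ∈ E, v < 1}`;
class split `hB`: archimedean (✓ `archimedean_additive_valueGroup_units`) ↦ (3-L-c1), proper coarsening ↦ (3-L-d) + (3-L-c2); then the
chart vectors are put in normal form `θ(c_j, a_j, b_j)`, `a_j, b_j < p`, and coordinates are read componentwise in `ℤ³`. [folklore] -/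
theorem port_toricChart_lattice (p : ℕ) [Fact p.Prime] {k : Type} [Field k] [CharP k p]
    {K : Type} [Field K] [Algebra k K] (O : ValuationSubring K) (A : Subalgebra k K)
    (hAO : A.toSubring ≤ O.toSubring) (hAfg : A.FG) [IsFractionRing A K] (hdimA : ringKrullDim A ≤ 3)
    (hdim3 : ringKrullDim (locAtCentre A.toSubring O) = 3)
    (htd : ∀ hk : ∀ c : k, algebraMap k K c ∈ O, transcendenceDefect k O hk ≠ 0)
    {x y : K} (hx : x ≠ 0) (hy : y ≠ 0)
    (hP : ∀ a b : ℕ, a < p → b < p → (a ≠ 0 ∨ b ≠ 0) → ∀ z : K, z ≠ 0 →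
      O.valuation (x ^ a * y ^ b) ≠ O.valuation (z ^ p))
    (z : Fin 3 → K) (hz0 : ∀ i, z i ≠ 0) (hzv : ∀ i, O.valuation (z i) < 1)
    (hzV : ∀ i, ∃ w : K, w ≠ 0 ∧ O.valuation (z i) = O.valuation (w ^ p))
    (α β : K) (hα : O.valuation α = 1) (hβ : O.valuation β = 1) (eA eB : Fin 3 → ℤ)
    (hxA : x ^ p = α * ∏ i, z i ^ eA i) (hyB : y ^ p = β * ∏ i, z i ^ eB i)
    (E : Finset ((Fin 3 → ℤ) × (Fin p × Fin p)))
    (hE : ∀ e ∈ E, O.valuation ((∏ i, z i ^ e.1 i) * (x ^ (e.2.1 : ℕ) * y ^ (e.2.2 : ℕ))) ≤ 1) :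
    ∃ (ρ : ℕ), (ρ = 1 ∨ ρ = 2) ∧
      ∃ (c : Fin 3 → Fin 3 → ℤ) (a b : Fin 3 → ℕ), (∀ j, a j < p) ∧ (∀ j, b j < p) ∧
        (∀ j : Fin 3, (j : ℕ) < ρ → O.valuation ((∏ i, z i ^ c j i) * (x ^ a j * y ^ b j)) < 1) ∧
        (∀ j : Fin 3, ρ ≤ (j : ℕ) → O.valuation ((∏ i, z i ^ c j i) * (x ^ a j * y ^ b j)) = 1) ∧
        (∀ i : Fin 3, ∃ d : Fin 3 → ℤ, (∀ j : Fin 3, (j : ℕ) < ρ → 0 ≤ d j) ∧ (∃ j : Fin 3, (j : ℕ) < ρ ∧ 0 < d j) ∧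
          ∀ i' : Fin 3, (if i' = i then (p : ℤ) else 0) =
            ∑ j, d j * ((p : ℤ) * c j i' + (a j : ℤ) * eA i' + (b j : ℤ) * eB i')) ∧
        (∀ e ∈ E, ∃ d : Fin 3 → ℤ, (∀ j : Fin 3, (j : ℕ) < ρ → 0 ≤ d j) ∧
          (O.valuation ((∏ i, z i ^ e.1 i) * (x ^ (e.2.1 : ℕ) * y ^ (e.2.2 : ℕ))) = 1 → ∀ j : Fin 3, (j : ℕ) < ρ → d j = 0) ∧
          ∀ i' : Fin 3, (p : ℤ) * e.1 i' + ((e.2.1 : ℕ) : ℤ) * eA i' + ((e.2.2 : ℕ) : ℤ) * eB i' =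
            ∑ j, d j * ((p : ℤ) * c j i' + (a j : ℤ) * eA i' + (b j : ℤ) * eB i')) := by
  classical
  have hp := (Fact.out : p.Prime)
  have hp0 : (p : ℤ) ≠ 0 := by exact_mod_cast hp.ne_zero
  set V := O.valuation with hV
  choose w hw0 hwv using hzV
  have hVw : ∀ i, V (w i) ≠ 0 := fun i => (Valuation.ne_zero_iff V).mpr (hw0 i)
  -- the weights `ωᵢ = v(wᵢ)` in the additive value group `W`, and `Ω ℓ = Σ ℓᵢ • ωᵢ`
  let γ : Fin 3 → (ValuationSubring.ValueGroup O)ˣ := fun i => Units.mk0 (V (w i)) (hVw i)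
  let ω : Fin 3 → Additive (ValuationSubring.ValueGroup O)ˣ := fun i => Additive.ofMul (γ i)
  let Ω : (Fin 3 → ℤ) →+ Additive (ValuationSubring.ValueGroup O)ˣ :=
    { toFun := fun ℓ => ∑ i, ℓ i • ω i
      map_zero' := by simp
      map_add' := fun u u' => by
        simp only [Pi.add_apply, add_smul, Finset.sum_add_distrib] }
  have hΩ : ∀ ℓ : Fin 3 → ℤ, Ω ℓ = ∑ i, ℓ i • ω i := fun _ => rfl
  have hΩval : ∀ ℓ : Fin 3 → ℤ,
      ((Additive.toMul (Ω ℓ) : (ValuationSubring.ValueGroup O)ˣ) : ValuationSubring.ValueGroup O) = ∏ i, V (w i) ^ ℓ i := by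
    intro ℓ
    rw [hΩ, toMul_sum, Units.coe_prod]
    refine Finset.prod_congr rfl fun i _ => ?_
    rw [toMul_zsmul, Units.val_zpow_eq_zpow_val]
    rfl
  -- values of monomials = values of `Ω`
  have hval : ∀ (C : Fin 3 → ℤ) (a b : ℕ), V ((∏ i, z i ^ C i) * (x ^ a * y ^ b)) =
      ((Additive.toMul (Ω fun i => (p : ℤ) * C i + (a : ℤ) * eA i + (b : ℤ) * eB i) : (ValuationSubring.ValueGroup O)ˣ) :
        ValuationSubring.ValueGroup O) := by
    intro C a b
    rw [hΩval]
    exact valuation_monomial_eq_prod_weights p O hx hy z hz0 w hw0 hwv α β hα hβ eA eB hxA hyB C a b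
  have hlt_iff : ∀ ℓ : Fin 3 → ℤ,
      ((Additive.toMul (Ω ℓ) : (ValuationSubring.ValueGroup O)ˣ) : ValuationSubring.ValueGroup O) < 1 ↔ Ω ℓ < 0 := by
    intro ℓ
    rw [← Units.val_one, Units.val_lt_val, ← toMul_zero, Additive.toMul_lt]
  have heq_iff : ∀ ℓ : Fin 3 → ℤ,
      ((Additive.toMul (Ω ℓ) : (ValuationSubring.ValueGroup O)ˣ) : ValuationSubring.ValueGroup O) = 1 ↔ Ω ℓ = 0 := by
    intro ℓ
    rw [← Units.val_one, Units.val_inj, ← toMul_zero, Additive.toMul.apply_eq_iff_eq]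
  -- the exponent lattice, a basis, the weight `φ = -Ω|L`
  set L := Submodule.span ℤ (Set.range fun i : Fin 3 => (Pi.single i (p : ℤ) : Fin 3 → ℤ)) ⊔ Submodule.span ℤ {eA, eB} with hL
  obtain ⟨bL⟩ := toricLattice_basis p hp.pos eA eB
  let φ : ↥L →+ Additive (ValuationSubring.ValueGroup O)ˣ := -(Ω.comp L.subtype.toAddMonoidHom)
  have hφ : ∀ f : L, φ f = -Ω (f : Fin 3 → ℤ) := fun _ => rfl
  -- rank ≤ 2 ⟹ a relation; `v(z₀) < 1` ⟹ non-triviality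
  have hk : ∀ c : k, algebraMap k K c ∈ O := fun c => hAO (A.algebraMap_mem c)
  have hW := RankOneArchimedean.ratRank_le_two_of_stub O A hAfg (ringKrullDim_eq_three_of_locAtCentre O A hAO hdimA hdim3) htd hk
  have hrel : ∃ f : L, f ≠ 0 ∧ φ f = 0 := RankOneArchimedean.exists_ne_zero_map_eq_zero_of_rank_le_two bL hW φ
  have hδmem : ∀ i : Fin 3, (Pi.single i (p : ℤ) : Fin 3 → ℤ) ∈ L := fun i =>
    Submodule.mem_sup_left (Submodule.subset_span ⟨i, rfl⟩)
  have hδval : ∀ i : Fin 3,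
      ((Additive.toMul (Ω (Pi.single i (p : ℤ))) : (ValuationSubring.ValueGroup O)ˣ) : ValuationSubring.ValueGroup O) = V (z i) := by
    intro i
    rw [hΩval, Finset.prod_eq_single i, Pi.single_eq_same, zpow_natCast, ← map_pow, hwv i]
    · intro j _ hj
      rw [Pi.single_eq_of_ne hj, zpow_zero]
    · intro h
      exact absurd (Finset.mem_univ i) h
  have hδpos : ∀ i : Fin 3, 0 < φ ⟨Pi.single i (p : ℤ), hδmem i⟩ := by
    intro i
    rw [hφ, neg_pos, ← hlt_iff, Subtype.coe_mk, hδval]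
    exact hzv i
  have hne : ∃ f : L, φ f ≠ 0 := ⟨⟨Pi.single 0 (p : ℤ), hδmem 0⟩, (hδpos 0).ne'⟩
  -- the finite set `F = {p·δᵢ} ∪ {θ e : e ∈ E, v < 1}`
  have hθmem : ∀ e : (Fin 3 → ℤ) × (Fin p × Fin p),
      (fun i => (p : ℤ) * e.1 i + ((e.2.1 : ℕ) : ℤ) * eA i + ((e.2.2 : ℕ) : ℤ) * eB i) ∈ L := fun e =>
    (mem_toricLattice_iff (p : ℤ) eA eB _).mpr ⟨e.1, _, _, fun i => rfl⟩
  let δL : Fin 3 → ↥L := fun i => ⟨Pi.single i (p : ℤ), hδmem i⟩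
  let θE : (Fin 3 → ℤ) × (Fin p × Fin p) → ↥L := fun e =>
    ⟨fun i => (p : ℤ) * e.1 i + ((e.2.1 : ℕ) : ℤ) * eA i + ((e.2.2 : ℕ) : ℤ) * eB i, hθmem e⟩
  let F : Finset ↥L := (Finset.univ.image δL) ∪
    ((E.filter fun e => V ((∏ i, z i ^ e.1 i) * (x ^ (e.2.1 : ℕ) * y ^ (e.2.2 : ℕ))) < 1).image θE)
  have hFδ : ∀ i, δL i ∈ F := fun i => Finset.mem_union_left _ (Finset.mem_image.mpr ⟨i, Finset.mem_univ i, rfl⟩)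
  have hFθ : ∀ e ∈ E, V ((∏ i, z i ^ e.1 i) * (x ^ (e.2.1 : ℕ) * y ^ (e.2.2 : ℕ))) < 1 → θE e ∈ F := fun e he hlt =>
    Finset.mem_union_right _ (Finset.mem_image.mpr ⟨e, Finset.mem_filter.mpr ⟨he, hlt⟩, rfl⟩)
  have hF : ∀ f ∈ F, 0 < φ f := by
    intro f hf
    rcases Finset.mem_union.mp hf with h | h
    · obtain ⟨i, -, rfl⟩ := Finset.mem_image.mp h
      exact hδpos i
    · obtain ⟨e, he, rfl⟩ := Finset.mem_image.mp h
      have hlt := (Finset.mem_filter.mp he).2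
      rw [hφ, neg_pos, ← hlt_iff]
      show ((Additive.toMul (Ω fun i => (p : ℤ) * e.1 i + ((e.2.1 : ℕ) : ℤ) * eA i + ((e.2.2 : ℕ) : ℤ) * eB i) :
        (ValuationSubring.ValueGroup O)ˣ) : ValuationSubring.ValueGroup O) < 1
      rw [← hval]
      exact hlt
  -- THE CHART (class split)
  obtain ⟨ρ, hρ, M, hMpos, hMzero, hFd, hKd⟩ : ∃ (ρ : ℕ), (ρ = 1 ∨ ρ = 2) ∧ ∃ M : Fin 3 → ↥L,
      (∀ j : Fin 3, (j : ℕ) < ρ → 0 < φ (M j)) ∧ (∀ j : Fin 3, ρ ≤ (j : ℕ) → φ (M j) = 0) ∧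
      (∀ f ∈ F, ∃ d : Fin 3 → ℤ, f = ∑ j, d j • M j ∧ (∀ j : Fin 3, (j : ℕ) < ρ → 0 ≤ d j) ∧
        ∃ j : Fin 3, (j : ℕ) < ρ ∧ 0 < d j) ∧
      (∀ f : ↥L, φ f = 0 → ∃ d : Fin 3 → ℤ, f = ∑ j, d j • M j ∧ ∀ j : Fin 3, (j : ℕ) < ρ → d j = 0) := by
    by_cases hB : ∀ O₁ : ValuationSubring K, O ≤ O₁ → O₁ = O ∨ O₁ = ⊤
    · haveI := RankOneArchimedean.archimedean_additive_valueGroup_units O hB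
      exact latticeChart_of_archimedean bL φ hrel hne F hF
    · obtain ⟨O₁, ψ, hψ, hW₁, hΔ⟩ := valueGroup_twoLevel_data O hW hB
      exact latticeChart_of_twoLevel bL φ ψ hψ hW₁ hΔ hrel hne F hF
  -- normal forms of the chart vectors
  have hnf : ∀ j : Fin 3, ∃ (C : Fin 3 → ℤ) (a b : ℕ), a < p ∧ b < p ∧
      ∀ i, (M j : Fin 3 → ℤ) i = (p : ℤ) * C i + (a : ℤ) * eA i + (b : ℤ) * eB i := by
    intro j
    obtain ⟨C, a, b, h⟩ := (mem_toricLattice_iff (p : ℤ) eA eB _).mp (M j).2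
    obtain ⟨C', a', b', ha', hb', h'⟩ := toricLattice_normalForm p hp.pos eA eB C a b
    exact ⟨C', a', b', ha', hb', fun i => (h i).trans (h' i)⟩
  choose c a b ha hb hM using hnf
  have hMvec : ∀ j, (M j : Fin 3 → ℤ) = fun i => (p : ℤ) * c j i + (a j : ℤ) * eA i + (b j : ℤ) * eB i :=
    fun j => funext (hM j)
  have hvalM : ∀ j, V ((∏ i, z i ^ c j i) * (x ^ a j * y ^ b j)) =
      ((Additive.toMul (Ω (M j : Fin 3 → ℤ)) : (ValuationSubring.ValueGroup O)ˣ) : ValuationSubring.ValueGroup O) := by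
    intro j
    rw [hval, ← hMvec j]
  -- reading coordinates componentwise in `ℤ³`
  have hcoord : ∀ (f : ↥L) (d : Fin 3 → ℤ), f = ∑ j, d j • M j → ∀ i' : Fin 3,
      (f : Fin 3 → ℤ) i' = ∑ j, d j * ((p : ℤ) * c j i' + (a j : ℤ) * eA i' + (b j : ℤ) * eB i') := by
    intro f d hf i'
    have h := congrArg (fun g : ↥L => (g : Fin 3 → ℤ) i') hf
    simp only [AddSubmonoidClass.coe_finsetSum, SetLike.val_smul, Finset.sum_apply, Pi.smul_apply, smul_eq_mul] at h
    rw [h]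
    exact Finset.sum_congr rfl fun j _ => by rw [hM j i']
  refine ⟨ρ, hρ, c, a, b, ha, hb, ?_, ?_, ?_, ?_⟩
  · intro j hj
    rw [hvalM j, hlt_iff, ← neg_pos, ← hφ]
    exact hMpos j hj
  · intro j hj
    rw [hvalM j, heq_iff, ← neg_eq_zero, ← hφ]
    exact hMzero j hj
  · intro i
    obtain ⟨d, hd, hd0, hdpos⟩ := hFd (δL i) (hFδ i)
    refine ⟨d, hd0, hdpos, fun i' => ?_⟩
    rw [← hcoord (δL i) d hd i']
    show (if i' = i then (p : ℤ) else 0) = (Pi.single i (p : ℤ) : Fin 3 → ℤ) i'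
    rw [Pi.single_apply]
  · intro e he
    by_cases hlt : V ((∏ i, z i ^ e.1 i) * (x ^ (e.2.1 : ℕ) * y ^ (e.2.2 : ℕ))) < 1
    · obtain ⟨d, hd, hd0, -⟩ := hFd (θE e) (hFθ e he hlt)
      exact ⟨d, hd0, fun h1 => absurd h1 (ne_of_lt hlt), fun i' => hcoord (θE e) d hd i'⟩
    · have h1 : V ((∏ i, z i ^ e.1 i) * (x ^ (e.2.1 : ℕ) * y ^ (e.2.2 : ℕ))) = 1 := le_antisymm (hE e he) (not_lt.mp hlt)
      have hφ0 : φ (θE e) = 0 := by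
        rw [hφ, neg_eq_zero, ← heq_iff]
        show ((Additive.toMul (Ω fun i => (p : ℤ) * e.1 i + ((e.2.1 : ℕ) : ℤ) * eA i + ((e.2.2 : ℕ) : ℤ) * eB i) :
          (ValuationSubring.ValueGroup O)ˣ) : ValuationSubring.ValueGroup O) = 1
        rw [← hval]
        exact h1
      obtain ⟨d, hd, hdz⟩ := hKd (θE e) hφ0
      exact ⟨d, fun j hj => le_of_eq (hdz j hj).symm, fun _ => hdz, fun i' => hcoord (θE e) d hd i'⟩

end Summit.ResolutionOfSingularities.ResolutionOfSingularities.Cruxes.DescentPerfectToAll.CpSibling.PRankTwoLattice
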